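import Literature.MathematicalPhysics.QuantumFieldTheory.Balaban1983to89.B4Lemma22ZeroBoxDerivDual
import Literature.MathematicalPhysics.QuantumFieldTheory.Balaban1983to89.B4Lower18
import Literature.MathematicalPhysics.QuantumFieldTheory.Balaban1983to89.B4TwoRegion120

/-!
# `Balaban1983to89.B4Delta112ZeroBox` — B4 p. 573 Theorem (Prop. 2.1 of [1]), the clause (1.11)–(1.12): BOTH
# inequalities (1.10) for `δG_k(Ω, Ω₀, 0) = G_k(Ω, 0) − G_k(Ω₀, 0)` «with the additional factor (1.12)», PROVED at
# `A = 0` for NESTED BLOCK-ALIGNED RECTANGULAR PARALLELEPIPEDS `Ω ⊂ Ω₀`, all scales `k ≥ 1`, without any restriction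
# on the point `x`

**Source.** T. Bałaban, *Regularity and Decay of Lattice Green's Functions*, Commun. Math. Phys. **89**, 571–597 (1983)
(bib key `Balaban1983RegularityDecay`, «B4» of the 1983–89 series): p. 572 [PDF 2] (1.2)–(1.6), p. 573 [PDF 3] the
Theorem (1.9)–(1.12), p. 579 [PDF 9] the `δG_k` paragraph of the proof and the remark on rectangular parallelepipeds,
p. 581 [PDF 11] the last sentence of Corollary 2.3 (journal page = PDF page + 570; renders
`b2b-balaban-ref1/pages/1983-cmp89-regularity-decay/1983-cmp89-regularity-decay-p003-x2.png`, `-p009-x2.png`,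
`-p011-x2.png`, read as images; transcript `HOME/b2b-balaban-b04/transcript-B4.md` ll. 29–32, 126–128, 154).  A new
leaf on top of `B4Thm110ZeroBox` (the value clause of (1.10) at `A = 0` for boxes, as the uniform weighted row bound
`thm110_zero_box_roww`) and `B4Thm110ZeroBoxDeriv` (the derivative clause, `thm110_zero_box_deriv_roww`), whose main
theorems and value-form corollaries (`mulVec_le_of_roww`, `abs_sum_mul_le_of_wsum`, `mulVec_sub_mulVec`) are USED BY
NAME on the two boxes `Ω`, `Ω₀`, together with the nested-box bookkeeping of `B4TwoBox120` (`Fits`, `emb`, `extNbrs`,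
`boxOpR_mulVec_outer_sub_inner`: `H(□₀)` and `H(□)` agree on functions vanishing on the boundary layer); no existing
module is touched; nothing of B4 is asserted as a fact.

## WHAT IS PRINTED (verbatim; `≦` of the print written `≤`)

p. 573: «**Theorem (Proposition 2.1 of [1]).** For α < 1 there exist positive constants δ₀, c₀, R₀ independent of
A, k, Ω and depending on d, M only, c₀ on α also, such that for e sufficiently small and for an arbitrary function
f : Ω → R^N, we have […] Similarly
|(D^η_{A,μ}G_k(Ω, A)f)(x)|, |(G_k(Ω, A)(x)| ≤ c₀ exp(−δ₀ dist(x, supp f))‖f‖_∞   (1.10)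
for x ∈ Ω, dist(x, Ω^c) ≥ R₀. If Ω ⊂ Ω₀, then for δG_k(Ω, Ω₀, A) defined by the equality
δG_k(Ω, Ω₀, A) = G_k(Ω, A) − G_k(Ω₀, A),   (1.11)
we have the inequalities (1.5) and (1.6) (with the same restrictions on x, x′) with the additional factor
exp(−δ₀ dist(supp f, Ω^c) − δ₀ dist(supp f, Ω^c))   (1.12)
on the right hand sides. For some simple sets Ω, e.g. for rectangular parallelepipeds, the inequalities hold without
any restrictions on the points x, x′, i.e. for all x, x′ ∈ Ω.»  ⟦sic: «(1.5) and (1.6)» are the definitions of `P_k(A)`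
and `G_k(Ω, A)`; (1.9) and (1.10) are meant.  ⟦sic: in (1.12) the same distance is printed twice (print defect G-B4-01);
the proof, p. 579, and Corollary 2.3, p. 581, give one distance for the evaluation point(s) and one for the source:
`exp(−δ₀dist(x, Ω^c) − δ₀dist(supp f, Ω^c))` for (1.10) — the TYPED READING adopted here (D-b04.2).⟧

p. 579: «To prove the corresponding inequalities for δG_k(Ω, Ω₀, A) = G_k(Ω, A) − G_k(Ω₀, A) with Ω ⊂ Ω₀, we take the
representations (2.13) for both propagators. The terms with ω such that □_{ω_i} are interior cubes of Ω are the same in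
both representations, so they cancel in the difference, and for δG_k we get a representation similar to (2.13) with
the additional restriction that at least one □_{ω_i} intersects the boundary ∂Ω. We estimate the terms of the
representation as above and we get the first inequality in (2.22) with 2^{d+1} instead of 2^d and with the restriction
n ≥ M^{−1} sup_{x₁∈Ω^c}(dist({x, x′}, x₁) + dist(x₁, supp f)) − 3 ≥ (2M)^{−1}(dist({x, x′}, supp f) + dist({x, x′}, Ω^c)
 + dist(supp f, Ω^c)) − 3.
It implies all the inequalities we need. Finally let us notice that if Ω is a rectangular parallelepiped, then all □_j
in the representation (2.13) are cubes and we can apply Lemma 2.2 to all operators in it, so the restriction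
dist({x, x′}, Ω^c) ≥ R₀ is unnecessary. Thus we have proved the theorem, or rather reduced it to Lemmas 2.1, 2.2.»

p. 581 (end of Corollary 2.3): «The same inequalities hold for δG_k(Ω, Ω₀, A) with the additional factor
e^{−δ₀(dist(supp f, Ω^c) + dist(supp f′, Ω^c))}.»

## WHAT THIS FILE CERTIFIES (kernel-checked, zero `sorry`, no hypotheses; the lineage is USED BY NAME, not re-proved)

For every dimension `d + 1`, every `L = ℓ + 1 ≥ 2` and every window `a ∈ [a₋, a₊]` (`a₋ > 0`), `m² ∈ [0, m²₊]` there are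
`δ₀ > 0`, `c₀ > 0` such that for EVERY scale `k ≥ 1` (`η = L^{-k}`, `n = L^k` fine points per unit length), every
`(a, m²)` in the window, every NESTED PAIR OF BLOCK-ALIGNED BOXES `Ω = s + Π_μ[0, M_μ) ⊂ Ω₀ = Π_μ[0, M₀_μ)` (integer corner
`s`, integer sides `M_μ ≥ 1`; `B4TwoBox120.Fits M M₀ s`; fine points `X = Π[0, nM_μ)`, `X₀ = Π[0, nM₀_μ)`, `x ↦ x + ns`
the inclusion `emb`), every `f : X → ℝ` with `|f| ≤ F`, every fine point `x ∈ X`, and all reals `D, D_b, D_f` with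
`D ≤ |x − z|_∞` on `supp f`, `D_b ≤ |x + ns − y|_∞` and `D_f ≤ |z + ns − y|_∞` (`z ∈ supp f`) for all fine points `y` of
`X₀` NOT in `X + ns` (i.e. `D_b`, `D_f` are dominated by the fine sup-distances of `x`, `supp f` to `Ω₀∖Ω ⊆ Ω^c`):
* `delta112_zero_box_value` (§7) — **the value clause of (1.10) with the factor (1.12)**:
  `|(δG_k(Ω,Ω₀,0)f)(x)| ≤ c₀ · e^{−δ₀D/n} · e^{−δ₀D_b/n − δ₀D_f/n} · F`;
* `delta112_zero_box_deriv` (§7) — **the derivative clause of (1.10) with the factor (1.12)**: for every axis `μ` with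
  `x + e_μ ∈ X` (distances measured from `x`), `|n·((δG_k f)(x + e_μ) − (δG_k f)(x))| ≤ c₀ · e^{−δ₀D/n} · e^{−δ₀D_b/n − δ₀D_f/n} · F`;
* `delta112_zero_box_value_coeff` / `delta112_zero_box_deriv_coeff` (§7) — the same two clauses for the operator with
  the LITERAL coefficient `a` of (1.6) ranging over the window (instead of the running `a_k = B1.aSeq a L k`);
* §8: the statements are instantiated at `d + 1 = 4`, `L = 2`, `a ∈ [1/2, 2]`, `m² ∈ [0, 1]`; a genuinely nested pair
  (`Ω = 1 + [0,1)^4 ⊂ [0,3)^4`) and the thin pair `Ω = Ω₀` inhabit `Fits` with `M_μ ≥ 1`, and `D = D_b = D_f = 0` always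
  meets the distance hypotheses, so nothing is vacuous.
Here `δG_k(Ω,Ω₀,0)f := G_k(Ω,0)f − (G_k(Ω₀,0)(Ef))∘emb` (§6 `dG`; `E` = extension by zero `ext`, §4),
`G_k(Ω,0) = (B4BoxCov237.boxOpR n a_k m² M)⁻¹`, `G_k(Ω₀,0) = (boxOpR n a_k m² M₀)⁻¹` — the propagator (1.6)/(1.9) at
`A = 0` in values form, exactly the object of `B4Thm110ZeroBox` / `B4Thm110ZeroBoxDeriv`.

MECHANISM (§1–§6; a short operator-theoretic route, NOT the print's).  Let `χ : X → [0,1]` be the product over the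
axes of discrete `C^{1,1}` profiles (§1–§2: `ψ_r(t) = r^{-2}Σ_{s<t}min(s, 2r − s)`, `r = ⌊n/4⌋ + 1`, so `2r ≤ n`; one
factor per interior face of `Ω`), with `χ = 0` on the fine points of `X` having an `X₀`-neighbour outside `X + ns`
(§3 `chi_eq_zero_of_extNbrs`), `χ = 1` at every point farther than `n` (fine sup-distance) from `Ω₀∖Ω`
(§3 `exists_near_of_chi_ne_one`), `|n(χ(z) − χ(z′))| ≤ 8` on bonds and `|n²Σ_{z′∼z}(χ(z) − χ(z′))| ≤ 64(d+1)` (§2,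
(C1)–(C2)).  Since `H(□₀)(Ev) = E(H(□)v)` for `v` vanishing on that layer (`B4TwoBox120.boxOpR_mulVec_outer_sub_inner`,
§4 `boxOpR_mulVec_ext`), with `u = G_k(Ω)f`:
`δG f = (1 − χ)u − G_k(Ω₀)E((1 − χ)f) + G_k(Ω₀)E([H(□), χ]u)`   (§4 `deltaG_decomp`),
`[H(□), χ]u(z) = Σ_{z′∼z} n(χ(z)−χ(z′))·n(u(z′)−u(z)) + u(z)·n²Σ_{z′∼z}(χ(z)−χ(z′)) + a_k n^{-(d+1)}Σ_{blk}(χ(z′)−χ(z))u(z′)`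
(§4 `comm_eq'`).  All three sources live within fine distance `2n` of `Ω₀∖Ω`; there the row bounds of nodes 6/7 on `Ω`
give `|u|, |n∇u| ≤ c·e^{3δ}e^{δ|x−z|_∞/n}·e^{−(δ/2)(D + D_b + D_f)/n}·F` through the lattice form of the printed distance
bookkeeping `(2M)^{-1}(dist(x, supp f) + dist(x, Ω^c) + dist(supp f, Ω^c)) − 3` (§5 `key_dist`:
`(D + D_b + D_f)/2 − 3n − |x − z|_∞ ≤ |z′ − z″|_∞`), and the row bounds on `Ω₀` pair the weight `e^{δ|x−z|_∞/n}` away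
(§5 `abs_sum_mul_le_of_weight`, §6 `core_value` / `core_deriv`, constant `c·e^{4δ}(10 + (80(d+1) + a₊)c)`, rate `δ/2`
with `δ = min`, `c = max` of the two nodes' constants, §7 `bounds_common`).

## DICTIONARY (typist's; each line is a reading, not a quotation; everything at `A = 0`, `U ≡ 1`, one component;
the dictionaries of `B4Thm110ZeroBox` / `B4Thm110ZeroBoxDeriv` for `□`, `G_k(□)`, `a_k`, `D^η_{0,μ}` apply verbatim)

* `Ω ⊂ Ω₀`, both rectangular parallelepipeds built of unit blocks ↦ `Fits M M₀ s` (`0 ≤ s_μ`, `s_μ + M_μ ≤ M₀_μ`); their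
  `η`-lattice points ↦ `boxDom (n·M)`, `boxDom (n·M₀)`, `n = L^k`; `Ω ∋ x ↦ x + ns ∈ Ω₀` ↦ `emb (hs.scale n)`.
* `G_k(Ω₀, A)` applied to «an arbitrary function f : Ω → R^N» ↦ `G_k(Ω₀, 0)(Ef)`, `E` = extension by zero (`ext`), read
  back on `Ω` — so `δG_k(Ω, Ω₀, 0)f ↦ dG n a_k m² hs f = (H(□)⁻¹f) − (H(□₀)⁻¹(Ef))∘emb`.
* `dist(x, supp f)`, `dist(x, Ω^c)`, `dist(supp f, Ω^c)` ↦ any reals `D/n`, `D_b/n`, `D_f/n` below the fine sup-distances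
  `|x − supp f|_∞`, `|x + ns − (X₀∖(X + ns))|_∞`, `|supp f + ns − (X₀∖(X + ns))|_∞` (unit = `n` fine sites, as in nodes
  6/7); since `Ω₀∖Ω ⊆ Ω^c` the printed distances to `Ω^c` are admissible values of `D_b/n`, `D_f/n` (the certified bound
  is the printed one or stronger; when `Ω = Ω₀` the set is empty, `D_b`, `D_f` are free and `δG = 0`).
* «additional factor (1.12)» ↦ `e^{−δ₀D_b/n − δ₀D_f/n}` multiplying the (1.10) bound `c₀e^{−δ₀D/n}‖f‖_∞`
  (`‖f‖_∞ ↦ F ≥ |f|` pointwise); «without any restrictions on the points x» ↦ every `x ∈ X` (resp. every bond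
  `⟨x, x + ηe_μ⟩ ⊂ Ω`).
* «constants δ₀, c₀ independent of A, k, Ω» ↦ `∃ δ₀ c₀` depending on `d`, `ℓ` and the window only — uniform in `k ≥ 1`,
  in the nested pair, in `x`, `μ`, `f` and in `(a, m²)`.

## HONEST SCOPE — what is NOT certified here

(i) Only `A = 0` (`D^η_{A,μ} = ∂^η_μ`, `U ≡ 1`, one component; «e sufficiently small» void).  (ii) Only NESTED BOXES:
`Ω` AND `Ω₀` rectangular parallelepipeds with corners in the unit lattice (the print: `Ω ⊂ Ω₀` arbitrary unions of big
blocks, with the restriction `dist(x, Ω^c) ≥ R₀` unless `Ω` is a parallelepiped; nothing is said here about non-box `Ω₀`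
or non-box `Ω`).  (iii) Only the two clauses of (1.10) (value and first difference derivative); NOT the Hölder clause
(1.9) for `δG_k`, NOT `A ≠ 0`.  (iv) Distances are `ℓ^∞` fine-lattice distances over `n` and to `Ω₀∖Ω` (see the
DICTIONARY); the constants are existential (`δ₀ = min(δ₆, δ₇)/2` of the two nodes' rates).  (v) ROUTE: NOT the
print's random-walk expansion (2.13)/(2.18) and its cancellation of interior-cube terms (p. 579) — instead the exact
cutoff–commutator identity above, fed by the two clauses of (1.10) at `A = 0` for boxes (nodes 6/7, themselves proved
over (2.34)–(2.39)) on `Ω` and on `Ω₀`; the print's distance bookkeeping survives as `key_dist`.  (vi) Relation to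
`B4Cor23ZeroDelta` (cell b04): that leaf certifies the `L²`-PAIRING sentence of Corollary 2.3 for `δG` on unions of
`n`-blocks over the carriers `B4Lower18.fineOpR`; this leaf certifies the POINTWISE `‖·‖_∞` clauses (1.10)·(1.12) over
`B4BoxCov237.boxOpR`; neither implies the other as typed, and the typed leaf `B4.Ineq111_112` (an abstract
`EtaSetting`) is not instantiated here — whether anything of `DagBinding`/`DagDischarged` is bound to this file is the
carver's call.

**Value = kernel certificate (the `δG_k` clause (1.11)–(1.12) of B4's Theorem at `A = 0` on nested boxes, all scales,
over the package's `A = 0` theorems), NOT summit progress**: the Yang–Mills / `Summit.QuantumFields` statements are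
untouched; no Literature fact is minted — every hypothesis used is kernel-proved in this package.
-/

namespace Literature.MathematicalPhysics.QuantumFieldTheory.Balaban1983to89.B4Delta112ZeroBox

open Finset Matrix
open Literature.MathematicalPhysics.QuantumFieldTheory.Balaban1983to89.B4ContourShift (supNorm supNorm_nonneg
  abs_le_supNorm)
open Literature.MathematicalPhysics.QuantumFieldTheory.Balaban1983to89.B4TorusKernel (supNorm_neg)
open Literature.MathematicalPhysics.QuantumFieldTheory.Balaban1983to89.B4Lower18 (supNorm_sub_le_one_of_mem_nbrs)
open Literature.MathematicalPhysics.QuantumFieldTheory.Balaban1983to89.B4TwoRegion120 (supNorm_sub_comm)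
open Literature.MathematicalPhysics.QuantumFieldTheory.Balaban1983to89.B4Reflection242
open Literature.MathematicalPhysics.QuantumFieldTheory.Balaban1983to89.B4BoxCov237
open Literature.MathematicalPhysics.QuantumFieldTheory.Balaban1983to89.B4Green242Bridge (boxNbrs boxBlk
  mem_boxNbrs_comm not_mem_boxNbrs_self mem_boxBlk_self)
open Literature.MathematicalPhysics.QuantumFieldTheory.Balaban1983to89.B4TwoBox120
open Literature.MathematicalPhysics.QuantumFieldTheory.Balaban1983to89.B4Thm110ZeroBox
open Literature.MathematicalPhysics.QuantumFieldTheory.Balaban1983to89.B4Thm110ZeroBoxDeriv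

noncomputable section

variable {d : ℕ}

/-! ## §1 A discrete `C^{1,1}` profile

`ψ_r(t) = r^{-2} Σ_{s<t} min(s, 2r − s)`: `ψ_r(0) = ψ_r(1) = 0`, `ψ_r ≡ 1` on `t ≥ 2r`, `|ψ_r(t+1) − ψ_r(t)| ≤ 1/r`,
`|ψ_r(t+2) − 2ψ_r(t+1) + ψ_r(t)| ≤ 1/r²`.  With `r = ⌊n/4⌋ + 1` (`2r ≤ n < 4r` for `n ≥ 2`) this is a cutoff profile
of width `≤ n` fine sites whose first and second lattice differences are `≤ 4/n` and `≤ 16/n²`. [folklore] -/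

section Profile

/-- the transition half-length `r = ⌊n/4⌋ + 1`. [folklore] -/
def rr (n : ℕ) : ℕ := n / 4 + 1

/-- `r ≥ 1`. [folklore] -/
theorem one_le_rr (n : ℕ) : 1 ≤ rr n := by unfold rr; omega

/-- `2r ≤ n` for `n ≥ 2`: the two profiles of one direction fit into the box. [folklore] -/
theorem two_mul_rr_le {n : ℕ} (hn : 2 ≤ n) : 2 * rr n ≤ n := by unfold rr; omega

/-- `n < 4r`: the profile slopes are `O(1/n)`. [folklore] -/
theorem lt_four_mul_rr (n : ℕ) : n < 4 * rr n := by unfold rr; omega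

/-- the slope sequence `θ_r(s) = min(s, 2r − s)` (a tent of height `r` on `[0, 2r]`, zero beyond). [folklore] -/
def slope (r s : ℕ) : ℕ := min s (2 * r - s)

/-- the tent has height `≤ r`. [folklore] -/
theorem slope_le (r s : ℕ) : slope r s ≤ r := by unfold slope; omega

/-- the tent starts at `0`. [folklore] -/
theorem slope_zero (r : ℕ) : slope r 0 = 0 := by unfold slope; omega

/-- the tent vanishes beyond `2r`. [folklore] -/
theorem slope_eq_zero_of_le {r s : ℕ} (h : 2 * r ≤ s) : slope r s = 0 := by unfold slope; omega

/-- the tent is `1`-Lipschitz. [folklore] -/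
theorem abs_slope_succ_sub_le (r s : ℕ) : |(slope r (s + 1) : ℝ) - slope r s| ≤ 1 := by
  have h1 : slope r (s + 1) ≤ slope r s + 1 := by unfold slope; omega
  have h2 : slope r s ≤ slope r (s + 1) + 1 := by unfold slope; omega
  have h1' : (slope r (s + 1) : ℝ) ≤ slope r s + 1 := by exact_mod_cast h1
  have h2' : (slope r s : ℝ) ≤ slope r (s + 1) + 1 := by exact_mod_cast h2
  rw [abs_sub_le_iff]; constructor <;> linarith

/-- the partial sums `P_r(t) = Σ_{s<t} θ_r(s)`. [folklore] -/
def psum (r t : ℕ) : ℕ := ∑ s ∈ Finset.range t, slope r s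

/-- `P_r(0) = 0`. [folklore] -/
theorem psum_zero (r : ℕ) : psum r 0 = 0 := by simp [psum]

/-- `P_r(t+1) = P_r(t) + θ_r(t)`. [folklore] -/
theorem psum_succ (r t : ℕ) : psum r (t + 1) = psum r t + slope r t := Finset.sum_range_succ _ _

/-- `P_r(1) = 0`. [folklore] -/
theorem psum_one (r : ℕ) : psum r 1 = 0 := by rw [psum_succ, psum_zero, slope_zero]

/-- `P_r(2r) = r²`: pair `s < r` with `r + s`; `θ(s) + θ(r+s) = s + (r − s) = r`. [folklore] -/
theorem psum_two_mul (r : ℕ) : psum r (2 * r) = r ^ 2 := by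
  unfold psum
  rw [two_mul, Finset.sum_range_add, ← Finset.sum_add_distrib]
  have h : ∀ x ∈ Finset.range r, slope r x + slope r (r + x) = r := by
    intro x hx; rw [Finset.mem_range] at hx; unfold slope; omega
  rw [Finset.sum_congr rfl h, Finset.sum_const, Finset.card_range, smul_eq_mul, sq]

/-- `P_r(t) = r²` for `t ≥ 2r`. [folklore] -/
theorem psum_of_le {r t : ℕ} (h : 2 * r ≤ t) : psum r t = r ^ 2 := by
  obtain ⟨j, rfl⟩ := Nat.exists_eq_add_of_le h
  clear h
  induction j with
  | zero => rw [add_zero, psum_two_mul]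
  | succ j ih => rw [← add_assoc, psum_succ, ih, slope_eq_zero_of_le (by omega), add_zero]

/-- `P_r` is monotone. [folklore] -/
theorem psum_mono (r : ℕ) {t t' : ℕ} (h : t ≤ t') : psum r t ≤ psum r t' :=
  Finset.sum_le_sum_of_subset (Finset.range_mono h)

/-- `P_r ≤ r²`. [folklore] -/
theorem psum_le (r t : ℕ) : psum r t ≤ r ^ 2 := by
  by_cases h : 2 * r ≤ t
  · exact (psum_of_le h).le
  · exact (psum_mono r (by omega : t ≤ 2 * r)).trans (psum_two_mul r).le

/-- the profile `ψ_r(t) = P_r(t)/r²`. [folklore] -/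
def prof (r t : ℕ) : ℝ := (psum r t : ℝ) / (r : ℝ) ^ 2

/-- `ψ_r ≥ 0`. [folklore] -/
theorem prof_nonneg (r t : ℕ) : 0 ≤ prof r t := by unfold prof; positivity

/-- `ψ_r ≤ 1`. [folklore] -/
theorem prof_le_one {r : ℕ} (hr : 1 ≤ r) (t : ℕ) : prof r t ≤ 1 := by
  unfold prof
  rw [div_le_one (by positivity)]
  exact_mod_cast psum_le r t

/-- `|ψ_r| ≤ 1`. [folklore] -/
theorem abs_prof_le_one {r : ℕ} (hr : 1 ≤ r) (t : ℕ) : |prof r t| ≤ 1 := by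
  rw [abs_of_nonneg (prof_nonneg r t)]; exact prof_le_one hr t

/-- `ψ_r(0) = 0`. [folklore] -/
theorem prof_zero (r : ℕ) : prof r 0 = 0 := by simp [prof, psum_zero]

/-- `ψ_r(1) = 0`. [folklore] -/
theorem prof_one (r : ℕ) : prof r 1 = 0 := by simp [prof, psum_one]

/-- `ψ_r(t) = 1` for `t ≥ 2r`. [folklore] -/
theorem prof_of_le {r t : ℕ} (hr : 1 ≤ r) (h : 2 * r ≤ t) : prof r t = 1 := by
  unfold prof
  rw [psum_of_le h]
  push_cast
  exact div_self (by positivity)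

/-- `ψ_r(t+1) − ψ_r(t) = θ_r(t)/r²`. [folklore] -/
theorem prof_succ_sub (r t : ℕ) : prof r (t + 1) - prof r t = slope r t / (r : ℝ) ^ 2 := by
  unfold prof
  rw [psum_succ]
  push_cast
  ring

/-- first differences: `|ψ(t+1) − ψ(t)| ≤ 1/r`. [folklore] -/
theorem abs_prof_succ_sub_le {r : ℕ} (hr : 1 ≤ r) (t : ℕ) : |prof r (t + 1) - prof r t| ≤ 1 / r := by
  rw [prof_succ_sub, abs_of_nonneg (by positivity)]
  have h1 : (slope r t : ℝ) ≤ r := by exact_mod_cast slope_le r t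
  have hr' : (0 : ℝ) < r := by exact_mod_cast hr
  rw [div_le_div_iff₀ (by positivity) hr']
  nlinarith

/-- second differences: `|ψ(t+2) − 2ψ(t+1) + ψ(t)| ≤ 1/r²`. [folklore] -/
theorem abs_prof_second_le {r : ℕ} (hr : 1 ≤ r) (t : ℕ) :
    |prof r (t + 2) - 2 * prof r (t + 1) + prof r t| ≤ 1 / (r : ℝ) ^ 2 := by
  have e : prof r (t + 2) - 2 * prof r (t + 1) + prof r t
      = ((slope r (t + 1) : ℝ) - slope r t) / (r : ℝ) ^ 2 := by
    have h1 := prof_succ_sub r (t + 1)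
    have h2 := prof_succ_sub r t
    rw [sub_div]
    linear_combination h1 - h2
  rw [e, abs_div, abs_of_pos (by positivity : (0 : ℝ) < (r : ℝ) ^ 2)]
  exact div_le_div_of_nonneg_right (abs_slope_succ_sub_le r t) (by positivity)

/-! ### The two-sided factor of one coordinate direction

On the fine interval `t ∈ [0, m − 1]` (`m = nM_μ` fine sites) the factor is `ψ(t)` if the LOWER face of the inner box is
interior to the outer box (`lo`), times `ψ(m − 1 − t)` if the UPPER face is interior (`hi`). -/

/-- the one-dimensional factor `φ(t) = (lo ? ψ_r(t) : 1)·(hi ? ψ_r(m−1−t) : 1)`, `r = rr n`. [folklore] -/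
def fac (n : ℕ) (lo hi : Bool) (m t : ℕ) : ℝ :=
  (if lo then prof (rr n) t else 1) * (if hi then prof (rr n) (m - 1 - t) else 1)

/-- the lower single factor. [folklore] -/
def facLo (n : ℕ) (lo : Bool) (t : ℕ) : ℝ := if lo then prof (rr n) t else 1

/-- the upper single factor. [folklore] -/
def facHi (n : ℕ) (hi : Bool) (m t : ℕ) : ℝ := if hi then prof (rr n) (m - 1 - t) else 1

/-- the two-sided factor is the product of its lower and upper single factors. [folklore] -/
theorem fac_eq (n : ℕ) (lo hi : Bool) (m t : ℕ) : fac n lo hi m t = facLo n lo t * facHi n hi m t := rfl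

/-- `0 ≤` the lower factor. [folklore] -/
theorem facLo_nonneg (n : ℕ) (lo : Bool) (t : ℕ) : 0 ≤ facLo n lo t := by
  unfold facLo; split_ifs; exacts [prof_nonneg _ _, zero_le_one]

/-- the lower factor `≤ 1`. [folklore] -/
theorem facLo_le_one (n : ℕ) (lo : Bool) (t : ℕ) : facLo n lo t ≤ 1 := by
  unfold facLo; split_ifs; exacts [prof_le_one (one_le_rr n) _, le_rfl]

/-- `0 ≤` the upper factor. [folklore] -/
theorem facHi_nonneg (n : ℕ) (hi : Bool) (m t : ℕ) : 0 ≤ facHi n hi m t := by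
  unfold facHi; split_ifs; exacts [prof_nonneg _ _, zero_le_one]

/-- the upper factor `≤ 1`. [folklore] -/
theorem facHi_le_one (n : ℕ) (hi : Bool) (m t : ℕ) : facHi n hi m t ≤ 1 := by
  unfold facHi; split_ifs; exacts [prof_le_one (one_le_rr n) _, le_rfl]

/-- `0 ≤` the two-sided factor. [folklore] -/
theorem fac_nonneg (n : ℕ) (lo hi : Bool) (m t : ℕ) : 0 ≤ fac n lo hi m t :=
  mul_nonneg (facLo_nonneg n lo t) (facHi_nonneg n hi m t)

/-- the two-sided factor `≤ 1`. [folklore] -/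
theorem fac_le_one (n : ℕ) (lo hi : Bool) (m t : ℕ) : fac n lo hi m t ≤ 1 := by
  rw [fac_eq]
  exact (mul_le_mul (facLo_le_one n lo t) (facHi_le_one n hi m t) (facHi_nonneg _ _ _ _) zero_le_one).trans
    (mul_one _).le

/-- `|fac| ≤ 1`. [folklore] -/
theorem abs_fac_le_one (n : ℕ) (lo hi : Bool) (m t : ℕ) : |fac n lo hi m t| ≤ 1 := by
  rw [abs_of_nonneg (fac_nonneg n lo hi m t)]; exact fac_le_one n lo hi m t

/-- `1/r ≤ 4/n`-type conversion: `n·(1/r) ≤ 4` for `r = rr n`. [folklore] -/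
theorem n_div_rr_le (n : ℕ) : (n : ℝ) * (1 / (rr n : ℝ)) ≤ 4 := by
  have hr : (0 : ℝ) < rr n := by exact_mod_cast one_le_rr n
  have h4 : (n : ℝ) ≤ 4 * rr n := by exact_mod_cast (lt_four_mul_rr n).le
  rw [mul_one_div, div_le_iff₀ hr]
  exact h4

/-- `n²/r² ≤ 16`. [folklore] -/
theorem nsq_div_rr_sq_le (n : ℕ) : (n : ℝ) ^ 2 * (1 / (rr n : ℝ) ^ 2) ≤ 16 := by
  have hr : (0 : ℝ) < rr n := by exact_mod_cast one_le_rr n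
  have h4 : (n : ℝ) ≤ 4 * rr n := by exact_mod_cast (lt_four_mul_rr n).le
  rw [mul_one_div, div_le_iff₀ (by positivity)]
  nlinarith

/-- first differences of the lower factor: `|A(t+1) − A(t)| ≤ 1/r`. [folklore] -/
theorem abs_facLo_succ_sub_le (n : ℕ) (lo : Bool) (t : ℕ) :
    |facLo n lo (t + 1) - facLo n lo t| ≤ 1 / (rr n : ℝ) := by
  unfold facLo
  cases lo
  · simp
  · simpa using abs_prof_succ_sub_le (one_le_rr n) t

/-- first differences of the upper factor (inside the interval): `|B(t+1) − B(t)| ≤ 1/r`. [folklore] -/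
theorem abs_facHi_succ_sub_le (n : ℕ) (hi : Bool) {m t : ℕ} (ht : t + 1 < m) :
    |facHi n hi m (t + 1) - facHi n hi m t| ≤ 1 / (rr n : ℝ) := by
  unfold facHi
  cases hi
  · simp
  · have e : m - 1 - t = (m - 1 - (t + 1)) + 1 := by omega
    simp only [if_true]
    rw [e, abs_sub_comm]
    exact abs_prof_succ_sub_le (one_le_rr n) _

/-- second differences of the lower factor: `|A(t+2) − 2A(t+1) + A(t)| ≤ 1/r²`. [folklore] -/
theorem abs_facLo_second_le (n : ℕ) (lo : Bool) (t : ℕ) :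
    |facLo n lo (t + 2) - 2 * facLo n lo (t + 1) + facLo n lo t| ≤ 1 / (rr n : ℝ) ^ 2 := by
  unfold facLo
  cases lo
  · norm_num
  · simpa using abs_prof_second_le (one_le_rr n) t

/-- second differences of the upper factor (inside the interval). [folklore] -/
theorem abs_facHi_second_le (n : ℕ) (hi : Bool) {m t : ℕ} (ht : t + 2 < m) :
    |facHi n hi m (t + 2) - 2 * facHi n hi m (t + 1) + facHi n hi m t| ≤ 1 / (rr n : ℝ) ^ 2 := by
  unfold facHi
  cases hi
  · norm_num
  · have e1 : m - 1 - t = (m - 1 - (t + 2)) + 2 := by omega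
    have e2 : m - 1 - (t + 1) = (m - 1 - (t + 2)) + 1 := by omega
    simp only [if_true]
    rw [e1, e2]
    have h := abs_prof_second_le (one_le_rr n) (m - 1 - (t + 2))
    rwa [show prof (rr n) (m - 1 - (t + 2) + 2) - 2 * prof (rr n) (m - 1 - (t + 2) + 1) + prof (rr n) (m - 1 - (t + 2))
      = prof (rr n) (m - 1 - (t + 2)) - 2 * prof (rr n) (m - 1 - (t + 2) + 1) + prof (rr n) (m - 1 - (t + 2) + 2)
      by ring] at h

/-- **FIRST DIFFERENCES**: `n·|φ(t+1) − φ(t)| ≤ 8` for `t + 1 < m`. [folklore] -/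
theorem abs_fac_succ_sub_le (n : ℕ) (lo hi : Bool) {m t : ℕ} (ht : t + 1 < m) :
    |(n : ℝ) * (fac n lo hi m (t + 1) - fac n lo hi m t)| ≤ 8 := by
  rw [fac_eq, fac_eq]
  set A := facLo n lo t
  set A' := facLo n lo (t + 1)
  set B := facHi n hi m t
  set B' := facHi n hi m (t + 1)
  have hA : |A' - A| ≤ 1 / (rr n : ℝ) := abs_facLo_succ_sub_le n lo t
  have hB : |B' - B| ≤ 1 / (rr n : ℝ) := abs_facHi_succ_sub_le n hi ht
  have hA1 : |A| ≤ 1 := by rw [abs_of_nonneg (facLo_nonneg _ _ _)]; exact facLo_le_one _ _ _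
  have hB1 : |B'| ≤ 1 := by rw [abs_of_nonneg (facHi_nonneg _ _ _ _)]; exact facHi_le_one _ _ _ _
  have e : A' * B' - A * B = (A' - A) * B' + A * (B' - B) := by ring
  have hn : (0 : ℝ) ≤ n := Nat.cast_nonneg n
  have h4 := n_div_rr_le n
  calc |(n : ℝ) * (A' * B' - A * B)| = n * |(A' - A) * B' + A * (B' - B)| := by
        rw [abs_mul, abs_of_nonneg hn, e]
    _ ≤ n * (|A' - A| * |B'| + |A| * |B' - B|) := by
        refine mul_le_mul_of_nonneg_left ((abs_add_le _ _).trans (le_of_eq ?_)) hn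
        rw [abs_mul, abs_mul]
    _ ≤ n * (1 / (rr n : ℝ) * 1 + 1 * (1 / (rr n : ℝ))) := by
        refine mul_le_mul_of_nonneg_left (add_le_add ?_ ?_) hn
        · exact mul_le_mul hA hB1 (abs_nonneg _) (by positivity)
        · exact mul_le_mul hA1 hB (abs_nonneg _) zero_le_one
    _ = 2 * ((n : ℝ) * (1 / (rr n : ℝ))) := by ring
    _ ≤ 8 := by linarith

/-- **SECOND DIFFERENCES** (interior): `n²·|2φ(t+1) − φ(t+2) − φ(t)| ≤ 64` for `t + 2 < m`. [folklore] -/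
theorem abs_fac_second_le (n : ℕ) (lo hi : Bool) {m t : ℕ} (ht : t + 2 < m) :
    |(n : ℝ) ^ 2 * (2 * fac n lo hi m (t + 1) - fac n lo hi m (t + 2) - fac n lo hi m t)| ≤ 64 := by
  simp only [fac_eq]
  set A0 := facLo n lo t
  set A1 := facLo n lo (t + 1)
  set A2 := facLo n lo (t + 2)
  set B0 := facHi n hi m t
  set B1 := facHi n hi m (t + 1)
  set B2 := facHi n hi m (t + 2)
  have hA : |A2 - 2 * A1 + A0| ≤ 1 / (rr n : ℝ) ^ 2 := abs_facLo_second_le n lo t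
  have hB : |B2 - 2 * B1 + B0| ≤ 1 / (rr n : ℝ) ^ 2 := abs_facHi_second_le n hi ht
  have hA' : |A2 - A0| ≤ 2 * (1 / (rr n : ℝ)) := by
    have h1 := abs_facLo_succ_sub_le n lo t
    have h2 := abs_facLo_succ_sub_le n lo (t + 1)
    calc |A2 - A0| = |(A2 - A1) + (A1 - A0)| := by ring_nf
      _ ≤ |A2 - A1| + |A1 - A0| := abs_add_le _ _
      _ ≤ _ := by linarith
  have hB' : |B1 - B0| ≤ 1 / (rr n : ℝ) := abs_facHi_succ_sub_le n hi (by omega)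
  have hB1 : |B1| ≤ 1 := by rw [abs_of_nonneg (facHi_nonneg _ _ _ _)]; exact facHi_le_one _ _ _ _
  have hA1 : |A2| ≤ 1 := by rw [abs_of_nonneg (facLo_nonneg _ _ _)]; exact facLo_le_one _ _ _
  -- discrete product rule
  have e : 2 * (A1 * B1) - A2 * B2 - A0 * B0
      = -(B1 * (A2 - 2 * A1 + A0) + A2 * (B2 - 2 * B1 + B0) + (A2 - A0) * (B1 - B0)) := by ring
  have hn : (0 : ℝ) ≤ (n : ℝ) ^ 2 := by positivity
  have hr : (0 : ℝ) < rr n := by exact_mod_cast one_le_rr n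
  have h16 := nsq_div_rr_sq_le n
  calc |(n : ℝ) ^ 2 * (2 * (A1 * B1) - A2 * B2 - A0 * B0)|
      = (n : ℝ) ^ 2 * |B1 * (A2 - 2 * A1 + A0) + A2 * (B2 - 2 * B1 + B0) + (A2 - A0) * (B1 - B0)| := by
        rw [abs_mul, abs_of_nonneg hn, e, abs_neg]
    _ ≤ (n : ℝ) ^ 2 * (|B1| * |A2 - 2 * A1 + A0| + |A2| * |B2 - 2 * B1 + B0| + |A2 - A0| * |B1 - B0|) := by
        refine mul_le_mul_of_nonneg_left ?_ hn
        rw [← abs_mul, ← abs_mul, ← abs_mul]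
        exact abs_add_three _ _ _
    _ ≤ (n : ℝ) ^ 2 * (1 * (1 / (rr n : ℝ) ^ 2) + 1 * (1 / (rr n : ℝ) ^ 2)
          + 2 * (1 / (rr n : ℝ)) * (1 / (rr n : ℝ))) := by
        refine mul_le_mul_of_nonneg_left (add_le_add (add_le_add ?_ ?_) ?_) hn
        · exact mul_le_mul hB1 hA (abs_nonneg _) zero_le_one
        · exact mul_le_mul hA1 hB (abs_nonneg _) zero_le_one
        · exact mul_le_mul hA' hB' (abs_nonneg _) (by positivity)
    _ = 4 * ((n : ℝ) ^ 2 * (1 / (rr n : ℝ) ^ 2)) := by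
        field_simp
        ring
    _ ≤ 64 := by linarith

/-- the reflection symmetry `φ_{lo,hi}(m − 1 − t) = φ_{hi,lo}(t)` (`t ≤ m − 1`). [folklore] -/
theorem fac_reflect (n : ℕ) (lo hi : Bool) {m t : ℕ} (ht : t + 1 ≤ m) :
    fac n lo hi m (m - 1 - t) = fac n hi lo m t := by
  unfold fac
  rw [show m - 1 - (m - 1 - t) = t by omega, mul_comm]

/-- **ONE-SIDED END** (lower): `n²·|φ(0) − φ(1)| ≤ 64` (`2 ≤ n ≤ m`). [folklore] -/
theorem abs_fac_zero_sub_one_le {n : ℕ} (hn : 2 ≤ n) (lo hi : Bool) {m : ℕ} (hm : n ≤ m) :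
    |(n : ℝ) ^ 2 * (fac n lo hi m 0 - fac n lo hi m 1)| ≤ 64 := by
  unfold fac
  cases lo
  · cases hi
    · norm_num
    · simp only [Bool.false_eq_true, if_false, if_true, one_mul]
      have e : m - 1 - 0 = (m - 2) + 1 := by omega
      rw [e, show m - 1 - 1 = m - 2 by omega, prof_succ_sub]
      by_cases h2 : 2 * rr n ≤ m - 2
      · rw [slope_eq_zero_of_le h2]; norm_num
      · -- then `n ≤ 7`
        have hn7 : n ≤ 7 := by unfold rr at h2; omega
        have hr : (1 : ℝ) ≤ rr n := by exact_mod_cast one_le_rr n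
        have hs : (slope (rr n) (m - 2) : ℝ) ≤ rr n := by exact_mod_cast slope_le (rr n) (m - 2)
        have hn7' : (n : ℝ) ≤ 7 := by exact_mod_cast hn7
        rw [abs_mul, abs_of_nonneg (by positivity : (0 : ℝ) ≤ (n : ℝ) ^ 2),
          abs_of_nonneg (by positivity)]
        rw [← mul_div_assoc, div_le_iff₀ (by positivity)]
        have : (n : ℝ) ^ 2 ≤ 49 := by nlinarith
        nlinarith
  · simp only [if_true, prof_zero, prof_one, zero_mul, sub_zero, mul_zero, abs_zero]
    norm_num

/-- **ONE-SIDED END** (upper): `n²·|φ(m−1) − φ(m−2)| ≤ 64` (`2 ≤ n ≤ m`). [folklore] -/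
theorem abs_fac_last_sub_le {n : ℕ} (hn : 2 ≤ n) (lo hi : Bool) {m : ℕ} (hm : n ≤ m) :
    |(n : ℝ) ^ 2 * (fac n lo hi m (m - 1) - fac n lo hi m (m - 2))| ≤ 64 := by
  rw [show m - 1 = m - 1 - 0 by omega, show m - 2 = m - 1 - 1 by omega,
    fac_reflect n lo hi (by omega : 0 + 1 ≤ m), fac_reflect n lo hi (by omega : 1 + 1 ≤ m)]
  exact abs_fac_zero_sub_one_le hn hi lo hm

/-- `φ(t) ≠ 1` forces `t` within `2r` of an interior face. [folklore] -/
theorem fac_ne_one {n : ℕ} (lo hi : Bool) {m t : ℕ} (h : fac n lo hi m t ≠ 1) :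
    (lo = true ∧ t < 2 * rr n) ∨ (hi = true ∧ m - 1 - t < 2 * rr n) := by
  by_contra hc
  push Not at hc
  apply h
  unfold fac
  have h1 : (if lo then prof (rr n) t else 1) = 1 := by
    cases lo
    · rfl
    · exact (if_pos rfl).trans (prof_of_le (one_le_rr n) (hc.1 rfl))
  have h2 : (if hi then prof (rr n) (m - 1 - t) else 1) = 1 := by
    cases hi
    · rfl
    · exact (if_pos rfl).trans (prof_of_le (one_le_rr n) (hc.2 rfl))
  rw [h1, h2, mul_one]

/-- with the lower flag on, the factor vanishes at `t = 0`. [folklore] -/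
theorem fac_zero_of_lo (n : ℕ) (hi : Bool) (m : ℕ) : fac n true hi m 0 = 0 := by
  unfold fac; rw [if_pos rfl, prof_zero, zero_mul]

/-- with the upper flag on, the factor vanishes at `t = m − 1`. [folklore] -/
theorem fac_last_of_hi (n : ℕ) (lo : Bool) (m : ℕ) : fac n lo true m (m - 1) = 0 := by
  unfold fac; rw [if_pos rfl, Nat.sub_self, prof_zero, mul_zero]

end Profile

/-! ## §2 The product cutoff `χ` on the inner fine box

Inner fine box `X = Π_μ[0, nM_μ)`, sitting in the outer fine box `X₀ = Π_μ[0, nM₀_μ)` as the translate by `n·s`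
(`B4TwoBox120.Fits M M₀ s`).  In direction `μ` the lower face of the inner box is INTERIOR to the outer box iff
`s_μ ≥ 1`, the upper face iff `s_μ + M_μ < M₀_μ`; the cutoff bends down to `0` exactly towards the interior faces. -/

section Cutoff

/-- flag: the lower face in direction `μ` is interior (`s_μ ≥ 1`). [folklore] -/
def loF (s : Fin (d + 1) → ℤ) (μ : Fin (d + 1)) : Bool := decide (0 < s μ)

/-- flag: the upper face in direction `μ` is interior (`s_μ + M_μ < M₀_μ`). [folklore] -/
def hiF (M M0 : Fin (d + 1) → ℕ) (s : Fin (d + 1) → ℤ) (μ : Fin (d + 1)) : Bool :=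
  decide (s μ + (M μ : ℤ) < M0 μ)

/-- the factor of direction `μ` at the (integer) fine coordinate `t`. [folklore] -/
def fdir (n : ℕ) (M M0 : Fin (d + 1) → ℕ) (s : Fin (d + 1) → ℤ) (μ : Fin (d + 1)) (t : ℤ) : ℝ :=
  fac n (loF s μ) (hiF M M0 s μ) (n * M μ) t.toNat

/-- **THE CUTOFF** `χ(y) = Π_μ φ_μ(y_μ)` (used on the inner fine box). [folklore] -/
def chi (n : ℕ) (M M0 : Fin (d + 1) → ℕ) (s : Fin (d + 1) → ℤ) (y : Fin (d + 1) → ℤ) : ℝ :=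
  ∏ μ, fdir n M M0 s μ (y μ)

/-- the product of the factors of the directions other than `μ`. [folklore] -/
def rest (n : ℕ) (M M0 : Fin (d + 1) → ℕ) (s : Fin (d + 1) → ℤ) (μ : Fin (d + 1)) (y : Fin (d + 1) → ℤ) : ℝ :=
  ∏ i ∈ Finset.univ.erase μ, fdir n M M0 s i (y i)

variable (n : ℕ) (M M0 : Fin (d + 1) → ℕ) (s : Fin (d + 1) → ℤ)

/-- the direction factor at a natural coordinate. [folklore] -/
theorem fdir_natCast (μ : Fin (d + 1)) (t : ℕ) :
    fdir n M M0 s μ (t : ℤ) = fac n (loF s μ) (hiF M M0 s μ) (n * M μ) t := by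
  simp [fdir]

/-- `0 ≤` the direction factor. [folklore] -/
theorem fdir_nonneg (μ : Fin (d + 1)) (t : ℤ) : 0 ≤ fdir n M M0 s μ t := fac_nonneg _ _ _ _ _

/-- the direction factor `≤ 1`. [folklore] -/
theorem fdir_le_one (μ : Fin (d + 1)) (t : ℤ) : fdir n M M0 s μ t ≤ 1 := fac_le_one _ _ _ _ _

/-- `0 ≤ χ`. [folklore] -/
theorem chi_nonneg (y : Fin (d + 1) → ℤ) : 0 ≤ chi n M M0 s y :=
  Finset.prod_nonneg fun μ _ => fdir_nonneg n M M0 s μ _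

/-- `χ ≤ 1`. [folklore] -/
theorem chi_le_one (y : Fin (d + 1) → ℤ) : chi n M M0 s y ≤ 1 :=
  Finset.prod_le_one (fun μ _ => fdir_nonneg n M M0 s μ _) fun μ _ => fdir_le_one n M M0 s μ _

/-- `|χ| ≤ 1`. [folklore] -/
theorem abs_chi_le_one (y : Fin (d + 1) → ℤ) : |chi n M M0 s y| ≤ 1 := by
  rw [abs_of_nonneg (chi_nonneg n M M0 s y)]; exact chi_le_one n M M0 s y

/-- `|1 − χ| ≤ 1`. [folklore] -/
theorem abs_one_sub_chi_le_one (y : Fin (d + 1) → ℤ) : |1 - chi n M M0 s y| ≤ 1 := by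
  rw [abs_of_nonneg (sub_nonneg.2 (chi_le_one n M M0 s y))]
  linarith [chi_nonneg n M M0 s y]

/-- `0 ≤` the product of the other directions' factors. [folklore] -/
theorem rest_nonneg (μ : Fin (d + 1)) (y : Fin (d + 1) → ℤ) : 0 ≤ rest n M M0 s μ y :=
  Finset.prod_nonneg fun i _ => fdir_nonneg n M M0 s i _

/-- that product is `≤ 1`. [folklore] -/
theorem rest_le_one (μ : Fin (d + 1)) (y : Fin (d + 1) → ℤ) : rest n M M0 s μ y ≤ 1 :=
  Finset.prod_le_one (fun i _ => fdir_nonneg n M M0 s i _) fun i _ => fdir_le_one n M M0 s i _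

/-- and `≤ 1` in absolute value. [folklore] -/
theorem abs_rest_le_one (μ : Fin (d + 1)) (y : Fin (d + 1) → ℤ) : |rest n M M0 s μ y| ≤ 1 := by
  rw [abs_of_nonneg (rest_nonneg n M M0 s μ y)]; exact rest_le_one n M M0 s μ y

/-- splitting off the factor of direction `μ`. [folklore] -/
theorem chi_eq_mul_rest (μ : Fin (d + 1)) (y : Fin (d + 1) → ℤ) :
    chi n M M0 s y = fdir n M M0 s μ (y μ) * rest n M M0 s μ y :=
  (Finset.mul_prod_erase Finset.univ (fun i => fdir n M M0 s i (y i)) (Finset.mem_univ μ)).symm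

/-- the other factors do not see a move in direction `μ`. [folklore] -/
theorem rest_add_single (μ : Fin (d + 1)) (y : Fin (d + 1) → ℤ) (c : ℤ) :
    rest n M M0 s μ (y + Pi.single μ c) = rest n M M0 s μ y := by
  unfold rest
  refine Finset.prod_congr rfl fun i hi => ?_
  rw [Pi.add_apply, Pi.single_eq_of_ne (Finset.ne_of_mem_erase hi), add_zero]

/-- the other directions' product is unchanged by a step `−e_μ`. [folklore] -/
theorem rest_sub_single (μ : Fin (d + 1)) (y : Fin (d + 1) → ℤ) (c : ℤ) :
    rest n M M0 s μ (y - Pi.single μ c) = rest n M M0 s μ y := by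
  unfold rest
  refine Finset.prod_congr rfl fun i hi => ?_
  rw [Pi.sub_apply, Pi.single_eq_of_ne (Finset.ne_of_mem_erase hi), sub_zero]

/-! ### box-membership of the two neighbours in direction `μ` -/

/-- `z + e_μ` is in the box iff `z_μ + 1 < N_μ`. [folklore] -/
theorem add_single_mem_iff {N : Fin (d + 1) → ℕ} {z : Fin (d + 1) → ℤ} (hz : z ∈ boxDom N) (μ : Fin (d + 1)) :
    z + Pi.single μ 1 ∈ boxDom N ↔ z μ + 1 < N μ := by
  rw [mem_boxDom] at hz ⊢
  constructor
  · intro h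
    have := (h μ).2
    simpa using this
  · intro h i
    by_cases hi : i = μ
    · subst hi
      simp only [Pi.add_apply, Pi.single_eq_same]
      exact ⟨by linarith [(hz i).1], h⟩
    · simp only [Pi.add_apply, Pi.single_eq_of_ne hi, add_zero]
      exact hz i

/-- `z − e_μ` is in the box iff `z_μ ≥ 1`. [folklore] -/
theorem sub_single_mem_iff {N : Fin (d + 1) → ℕ} {z : Fin (d + 1) → ℤ} (hz : z ∈ boxDom N) (μ : Fin (d + 1)) :
    z - Pi.single μ 1 ∈ boxDom N ↔ 1 ≤ z μ := by
  rw [mem_boxDom] at hz ⊢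
  constructor
  · intro h
    have := (h μ).1
    simp only [Pi.sub_apply, Pi.single_eq_same] at this
    linarith
  · intro h i
    by_cases hi : i = μ
    · subst hi
      simp only [Pi.sub_apply, Pi.single_eq_same]
      exact ⟨by linarith, by linarith [(hz i).2]⟩
    · simp only [Pi.sub_apply, Pi.single_eq_of_ne hi, sub_zero]
      exact hz i

/-- the fine coordinate of a box point as a natural number below the side length. [folklore] -/
theorem coord_eq_natCast {N : Fin (d + 1) → ℕ} {z : Fin (d + 1) → ℤ} (hz : z ∈ boxDom N) (μ : Fin (d + 1)) :
    ∃ t : ℕ, z μ = t ∧ t < N μ := by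
  obtain ⟨h0, h1⟩ := (mem_boxDom.1 hz) μ
  obtain ⟨t, ht⟩ := Int.eq_ofNat_of_zero_le h0
  refine ⟨t, ht, ?_⟩
  rw [ht] at h1
  exact_mod_cast h1

/-! ### (C1) first differences along box bonds: `n|χ(y) − χ(y′)| ≤ 8` -/

/-- **(C1)** `|n(χ(y) − χ(y′))| ≤ 8` for adjacent points `y, y′` of the inner fine box. [folklore] -/
theorem abs_chi_sub_nbr_le {y y' : Fin (d + 1) → ℤ} (hy : y ∈ boxDom (fun i => n * M i))
    (hy' : y' ∈ boxDom (fun i => n * M i)) (h : y' ∈ nbrs y) :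
    |(n : ℝ) * (chi n M M0 s y - chi n M M0 s y')| ≤ 8 := by
  obtain ⟨μ, h | h⟩ := mem_nbrs.1 h
  · -- `y' = y + e_μ`
    obtain ⟨t, ht, htm⟩ := coord_eq_natCast hy μ
    have h1 : y' μ = ((t + 1 : ℕ) : ℤ) := by rw [h]; simp [ht]
    have ht1 : t + 1 < n * M μ := by
      have := ((mem_boxDom.1 hy') μ).2
      rw [h1] at this
      exact_mod_cast this
    rw [chi_eq_mul_rest n M M0 s μ y, chi_eq_mul_rest n M M0 s μ y', h, rest_add_single, ← h, ht, h1,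
      fdir_natCast, fdir_natCast, ← sub_mul, ← mul_assoc, abs_mul]
    calc |(n : ℝ) * (fac n (loF s μ) (hiF M M0 s μ) (n * M μ) t - fac n (loF s μ) (hiF M M0 s μ) (n * M μ) (t + 1))|
          * |rest n M M0 s μ y| ≤ 8 * 1 := by
          refine mul_le_mul ?_ (abs_rest_le_one n M M0 s μ y) (abs_nonneg _) (by norm_num)
          rw [← abs_neg, ← mul_neg, neg_sub]
          exact abs_fac_succ_sub_le n _ _ ht1
      _ = 8 := by norm_num
  · -- `y' = y − e_μ`
    obtain ⟨t, ht, htm⟩ := coord_eq_natCast hy' μ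
    have h1 : y μ = ((t + 1 : ℕ) : ℤ) := by
      have : y' μ = y μ - 1 := by rw [h]; simp
      push_cast
      linarith
    have ht1 : t + 1 < n * M μ := by
      have := ((mem_boxDom.1 hy) μ).2
      rw [h1] at this
      exact_mod_cast this
    rw [chi_eq_mul_rest n M M0 s μ y, chi_eq_mul_rest n M M0 s μ y', h, rest_sub_single, ← h, ht, h1,
      fdir_natCast, fdir_natCast, ← sub_mul, ← mul_assoc, abs_mul]
    calc |(n : ℝ) * (fac n (loF s μ) (hiF M M0 s μ) (n * M μ) (t + 1) - fac n (loF s μ) (hiF M M0 s μ) (n * M μ) t)|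
          * |rest n M M0 s μ y| ≤ 8 * 1 :=
          mul_le_mul (abs_fac_succ_sub_le n _ _ ht1) (abs_rest_le_one n M M0 s μ y) (abs_nonneg _) (by norm_num)
      _ = 8 := by norm_num

/-! ### (C2) the Neumann Laplacian of `χ`: `|n² Σ_{y′ ∼ y, y′ ∈ X}(χ(y) − χ(y′))| ≤ 64(d+1)` -/

/-- sums over the nearest neighbours, real-valued version of `B4Green242Bridge.sum_nbrs`. [folklore] -/
theorem sum_nbrs_real (φ : (Fin (d + 1) → ℤ) → ℝ) (x : Fin (d + 1) → ℤ) :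
    ∑ z ∈ nbrs x, φ z = ∑ μ, (φ (x + Pi.single μ 1) + φ (x - Pi.single μ 1)) := by
  have h := B4Green242Bridge.sum_nbrs (fun z => (φ z : ℂ)) x
  rw [Finset.sum_add_distrib]
  exact_mod_cast h

/-- a sum over the box neighbours is a sum over all lattice neighbours of the box-restricted summand. [folklore] -/
theorem sum_boxNbrs_eq_sum_nbrs {N : Fin (d + 1) → ℕ} (z : ↥(boxDom N)) (g : (Fin (d + 1) → ℤ) → ℝ) :
    ∑ z' ∈ boxNbrs N z, g z'.1 = ∑ y ∈ nbrs z.1, if y ∈ boxDom N then g y else 0 := by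
  classical
  rw [← Finset.sum_filter]
  have e : (nbrs z.1).filter (fun y => y ∈ boxDom N) = (boxNbrs N z).map ⟨Subtype.val, Subtype.val_injective⟩ := by
    ext y
    simp only [Finset.mem_filter, Finset.mem_map, Function.Embedding.coeFn_mk, boxNbrs, Finset.mem_univ,
      true_and]
    constructor
    · rintro ⟨hy, hmem⟩
      exact ⟨⟨y, hmem⟩, hy, rfl⟩
    · rintro ⟨z', hz', rfl⟩
      exact ⟨hz', z'.2⟩
  rw [e, Finset.sum_map]
  rfl

/-- the one-directional second difference of `χ` with Neumann truncation, bounded by `64/n²`. [folklore] -/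
theorem abs_dir_second_le {n : ℕ} (hn : 2 ≤ n) (hM : ∀ i, 1 ≤ M i) {z : Fin (d + 1) → ℤ}
    (hz : z ∈ boxDom (fun i => n * M i)) (μ : Fin (d + 1)) :
    |(n : ℝ) ^ 2 * ((if z + Pi.single μ 1 ∈ boxDom (fun i => n * M i)
          then fdir n M M0 s μ (z μ) - fdir n M M0 s μ (z μ + 1) else 0)
        + (if z - Pi.single μ 1 ∈ boxDom (fun i => n * M i)
          then fdir n M M0 s μ (z μ) - fdir n M M0 s μ (z μ - 1) else 0))| ≤ 64 := by
  obtain ⟨t, ht, htm⟩ := coord_eq_natCast hz μ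
  have hnm : n ≤ n * M μ := Nat.le_mul_of_pos_right n (hM μ)
  have e1 : (t : ℤ) + 1 = ((t + 1 : ℕ) : ℤ) := by push_cast; ring
  by_cases hp : z + Pi.single μ 1 ∈ boxDom (fun i => n * M i)
  · have hp' : t + 1 < n * M μ := by
      have h1 := (add_single_mem_iff hz μ).1 hp
      rw [ht] at h1
      push_cast at h1
      omega
    rw [if_pos hp]
    by_cases hq : z - Pi.single μ 1 ∈ boxDom (fun i => n * M i)
    · rw [if_pos hq]
      have hq' : 1 ≤ t := by
        have h1 := (sub_single_mem_iff hz μ).1 hq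
        rw [ht] at h1
        omega
      obtain ⟨t', rfl⟩ : ∃ t', t = t' + 1 := ⟨t - 1, by omega⟩
      have e2 : ((t' + 1 : ℕ) : ℤ) - 1 = ((t' : ℕ) : ℤ) := by push_cast; ring
      rw [ht, e1, e2, fdir_natCast, fdir_natCast, fdir_natCast]
      have h := abs_fac_second_le n (loF s μ) (hiF M M0 s μ) (by omega : t' + 2 < n * M μ)
      rwa [show 2 * fac n (loF s μ) (hiF M M0 s μ) (n * M μ) (t' + 1) - fac n (loF s μ) (hiF M M0 s μ) (n * M μ) (t' + 2)
          - fac n (loF s μ) (hiF M M0 s μ) (n * M μ) t'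
          = fac n (loF s μ) (hiF M M0 s μ) (n * M μ) (t' + 1) - fac n (loF s μ) (hiF M M0 s μ) (n * M μ) (t' + 1 + 1)
            + (fac n (loF s μ) (hiF M M0 s μ) (n * M μ) (t' + 1) - fac n (loF s μ) (hiF M M0 s μ) (n * M μ) t')
          by ring] at h
    · rw [if_neg hq, add_zero]
      have ht0 : t = 0 := by
        have h1 : ¬((1 : ℤ) ≤ z μ) := fun h => hq ((sub_single_mem_iff hz μ).2 h)
        rw [ht] at h1
        omega
      rw [ht, e1, fdir_natCast, fdir_natCast, ht0]
      exact abs_fac_zero_sub_one_le hn _ _ hnm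
  · rw [if_neg hp, zero_add]
    have htl : t = n * M μ - 1 := by
      have h1 : ¬(z μ + 1 < ((fun i => n * M i) μ : ℕ)) := fun h => hp ((add_single_mem_iff hz μ).2 h)
      rw [ht] at h1
      push_cast at h1
      omega
    by_cases hq : z - Pi.single μ 1 ∈ boxDom (fun i => n * M i)
    · rw [if_pos hq]
      have hq' : 1 ≤ t := by
        have h1 := (sub_single_mem_iff hz μ).1 hq
        rw [ht] at h1
        omega
      have e2 : (t : ℤ) - 1 = ((t - 1 : ℕ) : ℤ) := by omega
      rw [ht, e2, fdir_natCast, fdir_natCast, htl, show n * M μ - 1 - 1 = n * M μ - 2 by omega]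
      exact abs_fac_last_sub_le hn _ _ hnm
    · rw [if_neg hq]
      norm_num

/-- **(C2)** the truncated (Neumann) Laplacian of the cutoff: `|n² Σ_{z′ ∈ X, z′ ∼ z}(χ(z) − χ(z′))| ≤ 64(d+1)`.
[folklore] -/
theorem abs_lap_chi_le {n : ℕ} (hn : 2 ≤ n) (hM : ∀ i, 1 ≤ M i) (z : ↥(boxDom (fun i => n * M i))) :
    |(n : ℝ) ^ 2 * ∑ z' ∈ boxNbrs (fun i => n * M i) z, (chi n M M0 s z.1 - chi n M M0 s z'.1)|
      ≤ 64 * ((d : ℝ) + 1) := by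
  rw [sum_boxNbrs_eq_sum_nbrs z (fun y => chi n M M0 s z.1 - chi n M M0 s y), sum_nbrs_real]
  -- per direction: factor out `rest`
  have key : ∀ μ : Fin (d + 1),
      (if z.1 + Pi.single μ 1 ∈ boxDom (fun i => n * M i) then chi n M M0 s z.1 - chi n M M0 s (z.1 + Pi.single μ 1)
        else 0)
      + (if z.1 - Pi.single μ 1 ∈ boxDom (fun i => n * M i) then chi n M M0 s z.1 - chi n M M0 s (z.1 - Pi.single μ 1)
        else 0)
      = rest n M M0 s μ z.1 *
        ((if z.1 + Pi.single μ 1 ∈ boxDom (fun i => n * M i)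
            then fdir n M M0 s μ (z.1 μ) - fdir n M M0 s μ (z.1 μ + 1) else 0)
          + (if z.1 - Pi.single μ 1 ∈ boxDom (fun i => n * M i)
            then fdir n M M0 s μ (z.1 μ) - fdir n M M0 s μ (z.1 μ - 1) else 0)) := by
    intro μ
    rw [chi_eq_mul_rest n M M0 s μ z.1, chi_eq_mul_rest n M M0 s μ (z.1 + Pi.single μ 1),
      chi_eq_mul_rest n M M0 s μ (z.1 - Pi.single μ 1), rest_add_single, rest_sub_single]
    simp only [Pi.add_apply, Pi.sub_apply, Pi.single_eq_same]
    split_ifs <;> ring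
  rw [Finset.sum_congr rfl fun μ _ => key μ, Finset.mul_sum]
  calc |∑ μ, (n : ℝ) ^ 2 * (rest n M M0 s μ z.1 * _)|
      ≤ ∑ μ, |(n : ℝ) ^ 2 * (rest n M M0 s μ z.1 * ((if z.1 + Pi.single μ 1 ∈ boxDom (fun i => n * M i)
            then fdir n M M0 s μ (z.1 μ) - fdir n M M0 s μ (z.1 μ + 1) else 0)
          + (if z.1 - Pi.single μ 1 ∈ boxDom (fun i => n * M i)
            then fdir n M M0 s μ (z.1 μ) - fdir n M M0 s μ (z.1 μ - 1) else 0)))| :=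
        Finset.abs_sum_le_sum_abs _ _
    _ ≤ ∑ _μ : Fin (d + 1), (64 : ℝ) := by
        refine Finset.sum_le_sum fun μ _ => ?_
        rw [mul_left_comm, abs_mul]
        calc |rest n M M0 s μ z.1| * _ ≤ 1 * 64 :=
              mul_le_mul (abs_rest_le_one n M M0 s μ z.1) (abs_dir_second_le M M0 s hn hM z.2 μ) (abs_nonneg _)
                zero_le_one
          _ = 64 := one_mul _
    _ = 64 * ((d : ℝ) + 1) := by
        rw [Finset.sum_const, Finset.card_univ, Fintype.card_fin, nsmul_eq_mul]
        push_cast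
        ring

end Cutoff

/-! ## §3 The cutoff and the nested pair of boxes: (C3) where `χ ≠ 1` the boundary is near, (C4) `χ = 0` on the
boundary layer -/

section CutoffNested

variable {n : ℕ} {M M0 : Fin (d + 1) → ℕ} {s : Fin (d + 1) → ℤ}

/-- **(C3)** at an inner point where `χ ≠ 1` there is an outer fine point OFF the (translated) inner box within
sup-distance `n` (one unit cube `η·n = 1`): the face towards which the profile bends is interior. [folklore] -/
theorem exists_near_of_chi_ne_one (hn : 2 ≤ n) (hs : Fits M M0 s) (hM : ∀ i, 1 ≤ M i)
    (z : ↥(boxDom (fun i => n * M i))) (h : chi n M M0 s z.1 ≠ 1) :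
    ∃ y : ↥(boxDom (fun i => n * M0 i)), (y.1 - fun i => (n : ℤ) * s i) ∉ boxDom (fun i => n * M i) ∧
      supNorm ((emb (hs.scale n) z).1 - y.1) ≤ n := by
  classical
  obtain ⟨μ, -, hμ⟩ : ∃ μ ∈ (Finset.univ : Finset (Fin (d + 1))), fdir n M M0 s μ (z.1 μ) ≠ 1 := by
    by_contra hc
    push Not at hc
    exact h (Finset.prod_eq_one hc)
  obtain ⟨t, ht, htm⟩ := coord_eq_natCast z.2 μ
  rw [ht, fdir_natCast] at hμ
  have hn1 : 1 ≤ n := by omega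
  have hr2 := two_mul_rr_le hn
  have hn' : (1 : ℤ) ≤ n := by exact_mod_cast hn1
  obtain ⟨hs0, hs1⟩ := hs μ
  have hM1 : (1 : ℤ) ≤ M μ := by exact_mod_cast hM μ
  have hzb := mem_boxDom.1 (emb (hs.scale n) z).2
  rcases fac_ne_one _ _ hμ with ⟨hlo, htr⟩ | ⟨hhi, htr⟩
  · -- lower face interior (`s_μ ≥ 1`): the witness has `μ`-coordinate `n s_μ − 1`
    have hsμ : 0 < s μ := of_decide_eq_true hlo
    refine ⟨⟨Function.update (emb (hs.scale n) z).1 μ ((n : ℤ) * s μ - 1), ?_⟩, ?_, ?_⟩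
    · rw [mem_boxDom]
      intro i
      by_cases hi : i = μ
      · subst hi
        rw [Function.update_self]
        constructor
        · nlinarith
        · push_cast
          nlinarith
      · rw [Function.update_of_ne hi]
        exact hzb i
    · intro hmem
      have h1 := ((mem_boxDom.1 hmem) μ).1
      simp only [Pi.sub_apply, Function.update_self] at h1
      linarith
    · refine supNorm_le_of_forall fun i => ?_
      by_cases hi : i = μ
      · subst hi
        simp only [Pi.sub_apply, Function.update_self, emb_val, Pi.add_apply]
        rw [ht]
        have e : (t : ℤ) + (n : ℤ) * s i - ((n : ℤ) * s i - 1) = ((t + 1 : ℕ) : ℤ) := by push_cast; ring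
        rw [e, abs_of_nonneg (by positivity)]
        exact_mod_cast (by omega : t + 1 ≤ n)
      · simp only [Pi.sub_apply, Function.update_of_ne hi, sub_self, abs_zero, Int.cast_zero]
        exact Nat.cast_nonneg n
  · -- upper face interior (`s_μ + M_μ < M₀_μ`): the witness has `μ`-coordinate `n(s_μ + M_μ)`
    have hsμ : s μ + (M μ : ℤ) < M0 μ := of_decide_eq_true hhi
    refine ⟨⟨Function.update (emb (hs.scale n) z).1 μ ((n : ℤ) * (s μ + M μ)), ?_⟩, ?_, ?_⟩
    · rw [mem_boxDom]
      intro i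
      by_cases hi : i = μ
      · subst hi
        rw [Function.update_self]
        constructor
        · positivity
        · push_cast
          nlinarith
      · rw [Function.update_of_ne hi]
        exact hzb i
    · intro hmem
      have h1 := ((mem_boxDom.1 hmem) μ).2
      simp only [Pi.sub_apply, Function.update_self] at h1
      push_cast at h1
      nlinarith
    · refine supNorm_le_of_forall fun i => ?_
      by_cases hi : i = μ
      · subst hi
        simp only [Pi.sub_apply, Function.update_self, emb_val, Pi.add_apply]
        rw [ht]
        have e : (t : ℤ) + (n : ℤ) * s i - (n : ℤ) * (s i + M i) = -(((n * M i - t : ℕ) : ℤ)) := by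
          push_cast [Nat.cast_sub htm.le]
          ring
        rw [e, abs_neg, abs_of_nonneg (by positivity)]
        exact_mod_cast (by omega : n * M i - t ≤ n)
      · simp only [Pi.sub_apply, Function.update_of_ne hi, sub_self, abs_zero, Int.cast_zero]
        exact Nat.cast_nonneg n

/-- **(C4)** the cutoff VANISHES ON THE BOUNDARY LAYER: at an inner point with a bond of `□₀` leaving `□`
(`extNbrs ≠ ∅`) some interior face passes through the point, and the profile of that direction is `0` there.
[folklore] -/
theorem chi_eq_zero_of_extNbrs (hn : 1 ≤ n) (hs : Fits M M0 s) (z : ↥(boxDom (fun i => n * M i)))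
    (h : (extNbrs n hs z).Nonempty) : chi n M M0 s z.1 = 0 := by
  obtain ⟨w, hw⟩ := h
  rw [mem_extNbrs] at hw
  obtain ⟨hw1, hw2⟩ := hw
  obtain ⟨μ, hμ | hμ⟩ := mem_nbrs.1 hw1
  · -- `w = emb z + e_μ`: the upper face in direction `μ`, and it is interior
    have e : (w.1 - fun i => (n : ℤ) * s i) = z.1 + Pi.single μ 1 := by rw [hμ, emb_val]; abel
    rw [e] at hw2
    obtain ⟨t, ht, htm⟩ := coord_eq_natCast z.2 μ
    have h1 : ¬(z.1 μ + 1 < ((fun i => n * M i) μ : ℕ)) := fun h => hw2 ((add_single_mem_iff z.2 μ).2 h)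
    rw [ht] at h1
    push_cast at h1
    have htl : t = n * M μ - 1 := by omega
    have hwμ := ((mem_boxDom.1 w.2) μ).2
    rw [hμ] at hwμ
    simp only [emb_val, Pi.add_apply, Pi.single_eq_same, ht] at hwμ
    push_cast at hwμ
    have hhi : hiF M M0 s μ = true := by
      apply decide_eq_true
      have key : (n : ℤ) * (s μ + M μ) < n * M0 μ := by linarith
      exact lt_of_mul_lt_mul_left key (by positivity)
    rw [chi_eq_mul_rest n M M0 s μ, ht, fdir_natCast, hhi, htl, fac_last_of_hi, zero_mul]
  · -- `w = emb z − e_μ`: the lower face in direction `μ`, and it is interior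
    have e : (w.1 - fun i => (n : ℤ) * s i) = z.1 - Pi.single μ 1 := by rw [hμ, emb_val]; abel
    rw [e] at hw2
    obtain ⟨t, ht, htm⟩ := coord_eq_natCast z.2 μ
    have h1 : ¬((1 : ℤ) ≤ z.1 μ) := fun h => hw2 ((sub_single_mem_iff z.2 μ).2 h)
    rw [ht] at h1
    have ht0 : t = 0 := by omega
    have hwμ := ((mem_boxDom.1 w.2) μ).1
    rw [hμ] at hwμ
    simp only [emb_val, Pi.sub_apply, Pi.add_apply, Pi.single_eq_same, ht, ht0] at hwμ
    push_cast at hwμ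
    have hlo : loF s μ = true := by
      apply decide_eq_true
      have hn0 : (0 : ℤ) ≤ n := by positivity
      by_contra hle
      push Not at hle
      nlinarith
    rw [chi_eq_mul_rest n M M0 s μ, ht, ht0, fdir_natCast, hlo, fac_zero_of_lo, zero_mul]

end CutoffNested

/-! ## §4 Extension by zero, the Neumann boundary identity, the commutator and the `δG` decomposition -/

section Nested

variable {n : ℕ} {M M0 : Fin (d + 1) → ℕ} {s : Fin (d + 1) → ℤ}

/-- extension by zero from the (translated) inner fine box to the outer fine box. [folklore] -/
def ext (n : ℕ) (M M0 : Fin (d + 1) → ℕ) (s : Fin (d + 1) → ℤ) (v : ↥(boxDom (fun i => n * M i)) → ℝ) :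
    ↥(boxDom (fun i => n * M0 i)) → ℝ := fun y =>
  if h : (y.1 - fun i => (n : ℤ) * s i) ∈ boxDom (fun i => n * M i) then v ⟨_, h⟩ else 0

/-- the extension by zero vanishes off the translated inner box. [folklore] -/
theorem ext_of_not_mem (v : ↥(boxDom (fun i => n * M i)) → ℝ) {y : ↥(boxDom (fun i => n * M0 i))}
    (hy : (y.1 - fun i => (n : ℤ) * s i) ∉ boxDom (fun i => n * M i)) : ext n M M0 s v y = 0 := dif_neg hy

/-- the extension by zero over the translated inner box. [folklore] -/
theorem ext_of_mem (v : ↥(boxDom (fun i => n * M i)) → ℝ) {y : ↥(boxDom (fun i => n * M0 i))}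
    (hy : (y.1 - fun i => (n : ℤ) * s i) ∈ boxDom (fun i => n * M i)) : ext n M M0 s v y = v ⟨_, hy⟩ := dif_pos hy

/-- an outer point over the inner box is the translate of the corresponding inner point. [folklore] -/
theorem emb_of_mem (hs : Fits M M0 s) {y : ↥(boxDom (fun i => n * M0 i))}
    (hy : (y.1 - fun i => (n : ℤ) * s i) ∈ boxDom (fun i => n * M i)) : emb (hs.scale n) ⟨_, hy⟩ = y :=
  Subtype.ext (by simp [emb_val])

/-- the extension agrees with the function on translated inner points. [folklore] -/
theorem ext_emb (hs : Fits M M0 s) (v : ↥(boxDom (fun i => n * M i)) → ℝ) (z : ↥(boxDom (fun i => n * M i))) :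
    ext n M M0 s v (emb (hs.scale n) z) = v z := by
  have h : ((emb (hs.scale n) z).1 - fun i => (n : ℤ) * s i) ∈ boxDom (fun i => n * M i) := by
    rw [emb_val, add_sub_cancel_right]; exact z.2
  rw [ext_of_mem v h]
  congr 1
  apply Subtype.ext
  simp [emb_val]

/-- **`H(□₀)·E = E·H(□)` ON FUNCTIONS VANISHING ON THE BOUNDARY LAYER** (`E` = extension by zero): by the Neumann
boundary identity of `B4TwoBox120` on translated inner points, and because an outer point off the inner box has
its in-range neighbours in the boundary layer and its block entirely off the inner box (block alignment).
[folklore] -/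
theorem boxOpR_mulVec_ext (hn : 1 ≤ n) (a m2 : ℝ) (hs : Fits M M0 s) (v : ↥(boxDom (fun i => n * M i)) → ℝ)
    (hv : ∀ z, (extNbrs n hs z).Nonempty → v z = 0) :
    (boxOpR n a m2 M0).mulVec (ext n M M0 s v) = ext n M M0 s ((boxOpR n a m2 M).mulVec v) := by
  funext y
  by_cases hy : (y.1 - fun i => (n : ℤ) * s i) ∈ boxDom (fun i => n * M i)
  · have hyz : y = emb (hs.scale n) ⟨_, hy⟩ := (emb_of_mem hs hy).symm
    rw [hyz, ext_emb hs]
    have h := boxOpR_mulVec_outer_sub_inner hn a m2 hs (ext n M M0 s v) ⟨_, hy⟩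
    have hfun : (fun z' => ext n M M0 s v (emb (hs.scale n) z')) = v := funext fun z' => ext_emb hs v z'
    rw [hfun] at h
    have hsum : ∑ w ∈ extNbrs n hs ⟨_, hy⟩, (ext n M M0 s v (emb (hs.scale n) ⟨_, hy⟩) - ext n M M0 s v w) = 0 := by
      by_cases hne : (extNbrs n hs ⟨_, hy⟩).Nonempty
      · refine Finset.sum_eq_zero fun w hw => ?_
        rw [ext_emb hs, hv _ hne, ext_of_not_mem v ((mem_extNbrs hs).1 hw).2, sub_zero]
      · rw [Finset.not_nonempty_iff_eq_empty.1 hne, Finset.sum_empty]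
    rw [hsum, mul_zero, sub_eq_zero] at h
    exact h
  · rw [ext_of_not_mem _ hy]
    unfold boxOpR
    rw [opBoxR_mulVec]
    have h0 : ext n M M0 s v y = 0 := ext_of_not_mem v hy
    have hN : ∀ y' ∈ boxNbrs (fun i => n * M0 i) y, ext n M M0 s v y' = 0 := by
      intro y' hy'
      by_cases hy'' : (y'.1 - fun i => (n : ℤ) * s i) ∈ boxDom (fun i => n * M i)
      · have hyz : y' = emb (hs.scale n) ⟨_, hy''⟩ := (emb_of_mem hs hy'').symm
        have hmem : y ∈ extNbrs n hs ⟨_, hy''⟩ := by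
          rw [mem_extNbrs]
          refine ⟨?_, hy⟩
          rw [← hyz]
          unfold boxNbrs at hy'
          rw [Finset.mem_filter] at hy'
          exact nbrs_comm.1 hy'.2
        rw [hyz, ext_emb hs, hv _ ⟨y, hmem⟩]
      · exact ext_of_not_mem v hy''
    have hB : ∀ y' ∈ boxBlk n (fun i => n * M0 i) y, ext n M M0 s v y' = 0 := by
      intro y' hy'
      by_cases hy'' : (y'.1 - fun i => (n : ℤ) * s i) ∈ boxDom (fun i => n * M i)
      · exfalso
        apply hy
        unfold boxBlk at hy'
        rw [Finset.mem_filter] at hy'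
        have hb : blk n (y'.1 - fun i => (n : ℤ) * s i) ∈ boxDom M := blk_mem_boxDom hn hy''
        have e : blk n (y'.1 - fun i => (n : ℤ) * s i) = blk n y.1 - s := by
          have h1 := blk_add_mul hn (y'.1 - fun i => (n : ℤ) * s i) s
          rw [sub_add_cancel] at h1
          rw [← hy'.2, h1, add_sub_cancel_right]
        rw [e] at hb
        exact sub_mem_boxDom_of_blk hn hb
      · exact ext_of_not_mem v hy''
    rw [h0, Finset.sum_eq_zero (fun y' hy' => by rw [hN y' hy', sub_zero]), Finset.sum_eq_zero hB]
    ring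

/-- the COMMUTATOR `[H(□), χ]u = H(χu) − χ·(Hu)` on the inner fine box. [folklore] -/
def comm (n : ℕ) (a m2 : ℝ) (M : Fin (d + 1) → ℕ) (χv u : ↥(boxDom (fun i => n * M i)) → ℝ) :
    ↥(boxDom (fun i => n * M i)) → ℝ := fun z =>
  (boxOpR n a m2 M).mulVec (fun z' => χv z' * u z') z - χv z * (boxOpR n a m2 M).mulVec u z

/-- **THE COMMUTATOR IS A FIRST-ORDER OPERATOR**: the mass term drops out and
`([H, χ]u)(z) = n² Σ_{z′ ∼ z}(χ(z) − χ(z′))u(z′) + (a/n^{d+1}) Σ_{z′ ∈ B(z)}(χ(z′) − χ(z))u(z′)`. [folklore] -/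
theorem comm_eq (n : ℕ) (a m2 : ℝ) (M : Fin (d + 1) → ℕ) (χv u : ↥(boxDom (fun i => n * M i)) → ℝ)
    (z : ↥(boxDom (fun i => n * M i))) :
    comm n a m2 M χv u z
      = (n : ℝ) ^ 2 * ∑ z' ∈ boxNbrs (fun i => n * M i) z, (χv z - χv z') * u z'
        + a * ((n : ℝ) ^ (d + 1))⁻¹ * ∑ z' ∈ boxBlk n (fun i => n * M i) z, (χv z' - χv z) * u z' := by
  unfold comm boxOpR
  rw [opBoxR_mulVec, opBoxR_mulVec]
  have h1 : ∑ z' ∈ boxNbrs (fun i => n * M i) z, (χv z - χv z') * u z'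
      = ∑ z' ∈ boxNbrs (fun i => n * M i) z, (χv z * u z - χv z' * u z')
        - χv z * ∑ z' ∈ boxNbrs (fun i => n * M i) z, (u z - u z') := by
    rw [Finset.mul_sum, ← Finset.sum_sub_distrib]
    exact Finset.sum_congr rfl fun z' _ => by ring
  have h2 : ∑ z' ∈ boxBlk n (fun i => n * M i) z, (χv z' - χv z) * u z'
      = ∑ z' ∈ boxBlk n (fun i => n * M i) z, χv z' * u z' - χv z * ∑ z' ∈ boxBlk n (fun i => n * M i) z, u z' := by
    rw [Finset.mul_sum, ← Finset.sum_sub_distrib]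
    exact Finset.sum_congr rfl fun z' _ => by ring
  rw [h1, h2]
  ring

/-- the second form of the commutator, separating the gradient of `u`:
`([H, χ]u)(z) = Σ_{z′ ∼ z} n(χ(z) − χ(z′))·n(u(z′) − u(z)) + u(z)·n²Σ_{z′ ∼ z}(χ(z) − χ(z′))
 + (a/n^{d+1}) Σ_{z′ ∈ B(z)}(χ(z′) − χ(z))u(z′)`. [folklore] -/
theorem comm_eq' (n : ℕ) (a m2 : ℝ) (M : Fin (d + 1) → ℕ) (χv u : ↥(boxDom (fun i => n * M i)) → ℝ)
    (z : ↥(boxDom (fun i => n * M i))) :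
    comm n a m2 M χv u z
      = ∑ z' ∈ boxNbrs (fun i => n * M i) z, (n : ℝ) * (χv z - χv z') * ((n : ℝ) * (u z' - u z))
        + u z * ((n : ℝ) ^ 2 * ∑ z' ∈ boxNbrs (fun i => n * M i) z, (χv z - χv z'))
        + a * ((n : ℝ) ^ (d + 1))⁻¹ * ∑ z' ∈ boxBlk n (fun i => n * M i) z, (χv z' - χv z) * u z' := by
  rw [comm_eq]
  congr 1
  simp only [Finset.mul_sum]
  rw [← Finset.sum_add_distrib]
  exact Finset.sum_congr rfl fun z' _ => by ring

/-- **THE `δG` DECOMPOSITION.**  With `G = H(□)⁻¹`, `G₀ = H(□₀)⁻¹`, `u = Gf` and a cutoff `χ` vanishing on the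
boundary layer: `(Gf)(x) − (G₀ Ef)(x + ns) = (1 − χ(x))u(x) − (G₀E((1−χ)f))(x + ns) + (G₀E([H,χ]u))(x + ns)`.
Indeed `H(□₀)E(χu) = E(H(□)(χu)) = E(χf + [H,χ]u)`, so `E(χu) = G₀E(χf) + G₀E([H,χ]u)`. [folklore] -/
theorem deltaG_decomp (hn : 1 ≤ n) {a m2 : ℝ} (ha : 0 < a) (hm : 0 ≤ m2) (hs : Fits M M0 s) (hM : ∀ i, 1 ≤ M i)
    (χv : ↥(boxDom (fun i => n * M i)) → ℝ) (hχ : ∀ z, (extNbrs n hs z).Nonempty → χv z = 0)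
    (f : ↥(boxDom (fun i => n * M i)) → ℝ) (x : ↥(boxDom (fun i => n * M i))) :
    ((boxOpR n a m2 M)⁻¹).mulVec f x - ((boxOpR n a m2 M0)⁻¹).mulVec (ext n M M0 s f) (emb (hs.scale n) x)
      = (1 - χv x) * ((boxOpR n a m2 M)⁻¹).mulVec f x
        - ((boxOpR n a m2 M0)⁻¹).mulVec (ext n M M0 s (fun z => (1 - χv z) * f z)) (emb (hs.scale n) x)
        + ((boxOpR n a m2 M0)⁻¹).mulVec
            (ext n M M0 s (comm n a m2 M χv (((boxOpR n a m2 M)⁻¹).mulVec f))) (emb (hs.scale n) x) := by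
  set H := boxOpR n a m2 M with hH
  set H0 := boxOpR n a m2 M0 with hH0
  set u := H⁻¹.mulVec f with hu
  have hM0 : ∀ i, 1 ≤ M0 i := fun i => hs.one_le hM i
  have hHu : H.mulVec u = f := by
    rw [hu, Matrix.mulVec_mulVec, hH, boxOpR_mul_inv hn ha hm hM, Matrix.one_mulVec]
  have hv : ∀ z, (extNbrs n hs z).Nonempty → (fun z' => χv z' * u z') z = 0 := fun z hz => by
    simp only
    rw [hχ z hz, zero_mul]
  have hid := boxOpR_mulVec_ext hn a m2 hs (fun z' => χv z' * u z') hv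
  have hHv : H.mulVec (fun z' => χv z' * u z') = fun z => χv z * f z + comm n a m2 M χv u z := by
    funext z
    simp only [comm, ← hH]
    rw [hHu]
    ring
  have hG : ext n M M0 s (fun z' => χv z' * u z')
      = H0⁻¹.mulVec (ext n M M0 s (H.mulVec fun z' => χv z' * u z')) := by
    rw [hH, hH0, ← hid, Matrix.mulVec_mulVec, boxOpR_inv_mul hn ha hm hM0, Matrix.one_mulVec]
  have h1 := congrFun hG (emb (hs.scale n) x)
  rw [ext_emb hs, hHv] at h1
  have hsplit : ext n M M0 s (fun z => χv z * f z + comm n a m2 M χv u z)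
      = ext n M M0 s f - ext n M M0 s (fun z => (1 - χv z) * f z) + ext n M M0 s (comm n a m2 M χv u) := by
    funext y
    simp only [ext, Pi.add_apply, Pi.sub_apply]
    split_ifs <;> ring
  rw [hsplit, Matrix.mulVec_add, Matrix.mulVec_sub] at h1
  simp only [Pi.add_apply, Pi.sub_apply] at h1
  linarith

end Nested

/-! ## §5 The analytic core: bounds from the four weighted row bounds

Throughout: inner fine box `X = Π[0,nM)`, outer `X₀ = Π[0,nM₀)`, `2 ≤ n`, and two kernels `G` on `X`, `G₀` on `X₀`
with weighted row bounds (`roww`, node 6) and weighted differenced-row bounds (`wsum`, node 7) at rate `δ` and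
height `c`.  Nothing else about `G`, `G₀` is used until the decomposition step, where `G = H(□)⁻¹`, `G₀ = H(□₀)⁻¹`. -/

section Core

variable {n : ℕ} {M M0 : Fin (d + 1) → ℕ} {s : Fin (d + 1) → ℤ}

/-- translated points have the same differences. [folklore] -/
theorem emb_sub_emb (hs : Fits M M0 s) (x z : ↥(boxDom (fun i => n * M i))) :
    (emb (hs.scale n) x).1 - (emb (hs.scale n) z).1 = x.1 - z.1 := by
  rw [emb_val, emb_val]; abel

/-- points of one `n`-block are at sup-distance `≤ n`. [folklore] -/
theorem supNorm_sub_le_of_boxBlk (hn : 1 ≤ n) {z z' : ↥(boxDom (fun i => n * M i))}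
    (hz' : z' ∈ boxBlk n (fun i => n * M i) z) : supNorm (z.1 - z'.1) ≤ n := by
  unfold boxBlk at hz'
  rw [Finset.mem_filter] at hz'
  have h := supNorm_sub_le_blk hn z.1 z'.1
  rw [← hz'.2, sub_self, supNorm_zero', zero_add, mul_one] at h
  exact h

/-- the box neighbours are at most `2(d+1)`. [folklore] -/
theorem card_boxNbrs_le {N : Fin (d + 1) → ℕ} (z : ↥(boxDom N)) : (boxNbrs N z).card ≤ 2 * (d + 1) := by
  rw [B4Green242Bridge.card_boxNbrs, ← card_nbrs z.1]
  exact Finset.card_filter_le _ _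

/-- the block of a fine box point has exactly `n^{d+1}` points. [folklore] -/
theorem card_boxBlk_eq (hn : 1 ≤ n) (z : ↥(boxDom (fun i => n * M i))) :
    (boxBlk n (fun i => n * M i) z).card = n ^ (d + 1) :=
  card_filter_blk hn M ⟨blk n z.1, blk_mem_boxDom hn z.2⟩

/-- the printed DECAY FACTOR `e^{−δ₀ dist(x, supp f)}·e^{−δ₀ dist(x, Ω^c) − δ₀ dist(supp f, Ω^c)}` in `η`-units
(`dist = D/n`). [folklore] -/
def dfac (δ₀ : ℝ) (n : ℕ) (D Db Df : ℝ) : ℝ :=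
  Real.exp (-(δ₀ * D / n)) * Real.exp (-(δ₀ * Db / n + δ₀ * Df / n))

/-- the decay factor is positive. [folklore] -/
theorem dfac_pos (δ₀ : ℝ) (n : ℕ) (D Db Df : ℝ) : 0 < dfac δ₀ n D Db Df :=
  mul_pos (Real.exp_pos _) (Real.exp_pos _)

/-- the exponent bookkeeping: `e^{−δD′/n} = e^{3δ}·e^{δρ/n}·dfac(δ/2)` for `D′ = (D + D_b + D_f)/2 − 3n − ρ`. [folklore] -/
theorem exp_Dprime {n : ℕ} (hn : 1 ≤ n) (δ D Db Df ρ : ℝ) :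
    Real.exp (-(δ * ((D + Db + Df) / 2 - 3 * n - ρ) / n))
      = Real.exp (3 * δ) * Real.exp (δ * ρ / n) * dfac (δ / 2) n D Db Df := by
  unfold dfac
  rw [← Real.exp_add, ← Real.exp_add, ← Real.exp_add]
  congr 1
  have hn' : (n : ℝ) ≠ 0 := by exact_mod_cast (show n ≠ 0 by omega)
  field_simp
  ring

/-- **WEIGHTED PAIRING**: a weighted `ℓ¹` row bound against a pointwise weighted bound. [folklore] -/
theorem abs_sum_mul_le_of_weight {N : Fin (d + 1) → ℕ} {δ c Φ : ℝ} (n : ℕ) (x : ↥(boxDom N))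
    (g h : ↥(boxDom N) → ℝ) (hg : ∑ y, |g y| * Real.exp (δ * supNorm (x.1 - y.1) / n) ≤ c) (hΦ : 0 ≤ Φ)
    (hh : ∀ y, |h y| ≤ Real.exp (δ * supNorm (x.1 - y.1) / n) * Φ) : |∑ y, g y * h y| ≤ c * Φ :=
  calc |∑ y, g y * h y| ≤ ∑ y, |g y| * |h y| :=
        (Finset.abs_sum_le_sum_abs _ _).trans (le_of_eq (Finset.sum_congr rfl fun y _ => abs_mul _ _))
    _ ≤ ∑ y, |g y| * (Real.exp (δ * supNorm (x.1 - y.1) / n) * Φ) :=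
        Finset.sum_le_sum fun y _ => mul_le_mul_of_nonneg_left (hh y) (abs_nonneg _)
    _ = (∑ y, |g y| * Real.exp (δ * supNorm (x.1 - y.1) / n)) * Φ := by
        rw [Finset.sum_mul]
        exact Finset.sum_congr rfl fun y _ => by ring
    _ ≤ c * Φ := mul_le_mul_of_nonneg_right hg hΦ

/-- `Bd z`: some outer fine point OFF the inner box lies within sup-distance `2n` of `emb z`
(the collar of width two unit cubes along the interior faces). [folklore] -/
def Bd (n : ℕ) {M M0 : Fin (d + 1) → ℕ} {s : Fin (d + 1) → ℤ} (hs : Fits M M0 s)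
    (z : ↥(boxDom (fun i => n * M i))) : Prop :=
  ∃ y : ↥(boxDom (fun i => n * M0 i)), (y.1 - fun i => (n : ℤ) * s i) ∉ boxDom (fun i => n * M i) ∧
    supNorm ((emb (hs.scale n) z).1 - y.1) ≤ 2 * n

/-- a point within `n` of a point where `χ ≠ 1` is in the collar. [folklore] -/
theorem bd_of_chi_ne_one (hn : 2 ≤ n) (hs : Fits M M0 s) (hM : ∀ i, 1 ≤ M i)
    {z z' : ↥(boxDom (fun i => n * M i))} (hzz' : supNorm (z.1 - z'.1) ≤ n) (h : chi n M M0 s z'.1 ≠ 1) :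
    Bd n hs z := by
  obtain ⟨y, hy, hd⟩ := exists_near_of_chi_ne_one hn hs hM z' h
  refine ⟨y, hy, ?_⟩
  have h1 := supNorm_sub_le_sub_add_sub (emb (hs.scale n) z).1 (emb (hs.scale n) z').1 y.1
  rw [emb_sub_emb hs] at h1
  linarith

/-- outside the collar the cutoff is `≡ 1` within distance `n`. [folklore] -/
theorem chi_eq_one_of_not_bd (hn : 2 ≤ n) (hs : Fits M M0 s) (hM : ∀ i, 1 ≤ M i)
    {z z' : ↥(boxDom (fun i => n * M i))} (hzz' : supNorm (z.1 - z'.1) ≤ n) (h : ¬Bd n hs z) :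
    chi n M M0 s z'.1 = 1 := by
  by_contra hc
  exact h (bd_of_chi_ne_one hn hs hM hzz' hc)

/-- **THE DISTANCE BOOKKEEPING** (the lattice version of p. 579, «(2M)^{−1}(dist({x,x′}, supp f) +
dist({x,x′}, Ω^c) + dist(supp f, Ω^c)) − 3»): for `z` in the collar and `z′` within `n` of `z`, every source
point `z″` satisfies `(D + D_b + D_f)/2 − 3n − |x − z|_∞ ≤ |z′ − z″|_∞`. [folklore] -/
theorem key_dist (hs : Fits M M0 s) {f : ↥(boxDom (fun i => n * M i)) → ℝ}
    {x z z' : ↥(boxDom (fun i => n * M i))} {D Db Df : ℝ}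
    (hD : ∀ z'', f z'' ≠ 0 → D ≤ supNorm (x.1 - z''.1))
    (hDb : ∀ y : ↥(boxDom (fun i => n * M0 i)), (y.1 - fun i => (n : ℤ) * s i) ∉ boxDom (fun i => n * M i) →
      Db ≤ supNorm ((emb (hs.scale n) x).1 - y.1))
    (hDf : ∀ z'', f z'' ≠ 0 → ∀ y : ↥(boxDom (fun i => n * M0 i)),
      (y.1 - fun i => (n : ℤ) * s i) ∉ boxDom (fun i => n * M i) → Df ≤ supNorm ((emb (hs.scale n) z'').1 - y.1))
    (hbd : Bd n hs z) (hzz' : supNorm (z.1 - z'.1) ≤ n) :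
    ∀ z'', f z'' ≠ 0 → (D + Db + Df) / 2 - 3 * n - supNorm (x.1 - z.1) ≤ supNorm (z'.1 - z''.1) := by
  intro z'' hf
  obtain ⟨y, hy, hzy⟩ := hbd
  have h1 := hD z'' hf
  have h2 := hDb y hy
  have h3 := hDf z'' hf y hy
  have t1 := supNorm_sub_le_sub_add_sub x.1 z.1 z''.1
  have t2 := supNorm_sub_le_sub_add_sub z.1 z'.1 z''.1
  have t3 := supNorm_sub_le_sub_add_sub (emb (hs.scale n) x).1 (emb (hs.scale n) z).1 y.1
  have t4 := supNorm_sub_le_sub_add_sub (emb (hs.scale n) z'').1 (emb (hs.scale n) z').1 y.1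
  have t5 := supNorm_sub_le_sub_add_sub (emb (hs.scale n) z').1 (emb (hs.scale n) z).1 y.1
  rw [emb_sub_emb hs] at t3 t4 t5
  rw [supNorm_sub_comm z''.1 z'.1] at t4
  rw [supNorm_sub_comm z'.1 z.1] at t5
  linarith

/-- **POINTWISE VALUES NEAR THE BOUNDARY**: `|(Gf)(z′)| ≤ c·e^{3δ}e^{δ|x−z|/n}·dfac·F` for `z` in the collar and
`z′` within `n` of `z` (node 6's `mulVec_le_of_roww` with the distance `D′` of `key_dist`). [folklore] -/
theorem value_pt (hn : 1 ≤ n) (hs : Fits M M0 s) {δ c : ℝ} (hδ : 0 ≤ δ)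
    (G : Matrix ↥(boxDom (fun i => n * M i)) ↥(boxDom (fun i => n * M i)) ℝ) (hS0 : ∀ z, roww δ n G z ≤ c)
    (f : ↥(boxDom (fun i => n * M i)) → ℝ) {F D Db Df : ℝ} (hF : ∀ z, |f z| ≤ F)
    (x : ↥(boxDom (fun i => n * M i)))
    (hD : ∀ z'', f z'' ≠ 0 → D ≤ supNorm (x.1 - z''.1))
    (hDb : ∀ y : ↥(boxDom (fun i => n * M0 i)), (y.1 - fun i => (n : ℤ) * s i) ∉ boxDom (fun i => n * M i) →
      Db ≤ supNorm ((emb (hs.scale n) x).1 - y.1))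
    (hDf : ∀ z'', f z'' ≠ 0 → ∀ y : ↥(boxDom (fun i => n * M0 i)),
      (y.1 - fun i => (n : ℤ) * s i) ∉ boxDom (fun i => n * M i) → Df ≤ supNorm ((emb (hs.scale n) z'').1 - y.1))
    {z z' : ↥(boxDom (fun i => n * M i))} (hbd : Bd n hs z) (hzz' : supNorm (z.1 - z'.1) ≤ n) :
    |(G *ᵥ f) z'| ≤ c * (Real.exp (3 * δ) * Real.exp (δ * supNorm (x.1 - z.1) / n) * dfac (δ / 2) n D Db Df) * F := by
  have hK := key_dist hs hD hDb hDf hbd hzz'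
  have h := mulVec_le_of_roww hδ n G z' (hS0 z') f hF hK
  rw [exp_Dprime hn] at h
  exact h

/-- **POINTWISE DIFFERENCES NEAR THE BOUNDARY**: `|n((Gf)(z′) − (Gf)(z))| ≤ c·e^{3δ}e^{δ|x−z|/n}·dfac·F` for
`z` in the collar and `z′` a box neighbour of `z` (node 7's `abs_sum_mul_le_of_wsum`). [folklore] -/
theorem deriv_pt (hn : 1 ≤ n) (hs : Fits M M0 s) {δ c : ℝ} (hδ : 0 ≤ δ)
    (G : Matrix ↥(boxDom (fun i => n * M i)) ↥(boxDom (fun i => n * M i)) ℝ)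
    (hS1 : ∀ (μ : Fin (d + 1)) (z ze : ↥(boxDom (fun i => n * M i))), ze.1 = z.1 + Pi.single μ 1 →
      wsum δ n z (fun z' => (n : ℝ) * (G ze z' - G z z')) ≤ c)
    (f : ↥(boxDom (fun i => n * M i)) → ℝ) {F D Db Df : ℝ} (hF : ∀ z, |f z| ≤ F)
    (x : ↥(boxDom (fun i => n * M i)))
    (hD : ∀ z'', f z'' ≠ 0 → D ≤ supNorm (x.1 - z''.1))
    (hDb : ∀ y : ↥(boxDom (fun i => n * M0 i)), (y.1 - fun i => (n : ℤ) * s i) ∉ boxDom (fun i => n * M i) →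
      Db ≤ supNorm ((emb (hs.scale n) x).1 - y.1))
    (hDf : ∀ z'', f z'' ≠ 0 → ∀ y : ↥(boxDom (fun i => n * M0 i)),
      (y.1 - fun i => (n : ℤ) * s i) ∉ boxDom (fun i => n * M i) → Df ≤ supNorm ((emb (hs.scale n) z'').1 - y.1))
    {z z' : ↥(boxDom (fun i => n * M i))} (hbd : Bd n hs z) (hz' : z' ∈ boxNbrs (fun i => n * M i) z) :
    |(n : ℝ) * ((G *ᵥ f) z' - (G *ᵥ f) z)|
      ≤ c * (Real.exp (3 * δ) * Real.exp (δ * supNorm (x.1 - z.1) / n) * dfac (δ / 2) n D Db Df) * F := by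
  have hz'' : z'.1 ∈ nbrs z.1 := by
    unfold boxNbrs at hz'
    rw [Finset.mem_filter] at hz'
    exact hz'.2
  obtain ⟨μ, hμ | hμ⟩ := mem_nbrs.1 hz''
  · -- `z′ = z + e_μ`: base point `z`
    have hK := key_dist hs hD hDb hDf hbd
      (show supNorm (z.1 - z.1) ≤ n by rw [sub_self, supNorm_zero']; exact Nat.cast_nonneg n)
    rw [mulVec_sub_mulVec G f z z' n]
    have h := abs_sum_mul_le_of_wsum hδ n z (fun z'' => (n : ℝ) * (G z' z'' - G z z'')) (hS1 μ z z' hμ) f hF hK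
    rw [exp_Dprime hn] at h
    exact h
  · -- `z′ = z − e_μ`: base point `z′`
    have hμ' : z.1 = z'.1 + Pi.single μ 1 := by rw [hμ]; abel
    have hK := key_dist hs hD hDb hDf hbd (supNorm_sub_le_one_of_mem_nbrs hz'' |>.trans (by exact_mod_cast hn))
    rw [show (n : ℝ) * ((G *ᵥ f) z' - (G *ᵥ f) z) = -((n : ℝ) * ((G *ᵥ f) z - (G *ᵥ f) z')) by ring, abs_neg,
      mulVec_sub_mulVec G f z' z n]
    have h := abs_sum_mul_le_of_wsum hδ n z' (fun z'' => (n : ℝ) * (G z z'' - G z' z'')) (hS1 μ z' z hμ') f hF hK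
    rw [exp_Dprime hn] at h
    exact h

/-- **THE CUT SOURCE**: `|(1 − χ(z))f(z)| ≤ e^{δ|x−z|/n}·(e^{δ}·dfac·F)` — where `χ ≠ 1` the boundary is within one
unit cube, so `D + D_b + D_f ≤ 2|x − z| + 2n` on such source points. [folklore] -/
theorem cutf_pt (hn : 2 ≤ n) (hs : Fits M M0 s) (hM : ∀ i, 1 ≤ M i) {δ : ℝ} (hδ : 0 ≤ δ)
    (f : ↥(boxDom (fun i => n * M i)) → ℝ) {F D Db Df : ℝ} (hF : ∀ z, |f z| ≤ F)
    (x : ↥(boxDom (fun i => n * M i)))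
    (hD : ∀ z'', f z'' ≠ 0 → D ≤ supNorm (x.1 - z''.1))
    (hDb : ∀ y : ↥(boxDom (fun i => n * M0 i)), (y.1 - fun i => (n : ℤ) * s i) ∉ boxDom (fun i => n * M i) →
      Db ≤ supNorm ((emb (hs.scale n) x).1 - y.1))
    (hDf : ∀ z'', f z'' ≠ 0 → ∀ y : ↥(boxDom (fun i => n * M0 i)),
      (y.1 - fun i => (n : ℤ) * s i) ∉ boxDom (fun i => n * M i) → Df ≤ supNorm ((emb (hs.scale n) z'').1 - y.1))
    (z : ↥(boxDom (fun i => n * M i))) :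
    |(1 - chi n M M0 s z.1) * f z|
      ≤ Real.exp (δ * supNorm (x.1 - z.1) / n) * (Real.exp δ * dfac (δ / 2) n D Db Df * F) := by
  have hF0 : 0 ≤ F := (abs_nonneg _).trans (hF x)
  by_cases hχ : chi n M M0 s z.1 = 1
  · rw [hχ, sub_self, zero_mul, abs_zero]
    exact mul_nonneg (Real.exp_pos _).le (mul_nonneg (mul_nonneg (Real.exp_pos _).le (dfac_pos _ _ _ _ _).le) hF0)
  by_cases hf : f z = 0
  · rw [hf, mul_zero, abs_zero]
    exact mul_nonneg (Real.exp_pos _).le (mul_nonneg (mul_nonneg (Real.exp_pos _).le (dfac_pos _ _ _ _ _).le) hF0)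
  obtain ⟨y, hy, hzy⟩ := exists_near_of_chi_ne_one hn hs hM z hχ
  have h1 := hD z hf
  have h2 := hDb y hy
  have h3 := hDf z hf y hy
  have t3 := supNorm_sub_le_sub_add_sub (emb (hs.scale n) x).1 (emb (hs.scale n) z).1 y.1
  rw [emb_sub_emb hs] at t3
  have hn0 : (0 : ℝ) < n := by exact_mod_cast (show 0 < n by omega)
  set ρ := supNorm (x.1 - z.1) with hρ
  have hsum : D + Db + Df ≤ 2 * ρ + 2 * n := by linarith
  -- the weight is ≥ 1
  have hw : 1 ≤ Real.exp (δ * ρ / n) * (Real.exp δ * dfac (δ / 2) n D Db Df) := by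
    unfold dfac
    rw [← Real.exp_add, ← Real.exp_add, ← Real.exp_add]
    apply Real.one_le_exp
    have e : δ * ρ / n + (δ + (-(δ / 2 * D / n) + -(δ / 2 * Db / n + δ / 2 * Df / n)))
        = δ / (2 * n) * (2 * ρ + 2 * n - D - Db - Df) := by
      field_simp
      ring
    rw [e]
    exact mul_nonneg (div_nonneg hδ (by positivity)) (by linarith)
  calc |(1 - chi n M M0 s z.1) * f z| = |1 - chi n M M0 s z.1| * |f z| := abs_mul _ _
    _ ≤ 1 * F := mul_le_mul (abs_one_sub_chi_le_one n M M0 s z.1) (hF z) (abs_nonneg _) zero_le_one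
    _ ≤ Real.exp (δ * ρ / n) * (Real.exp δ * dfac (δ / 2) n D Db Df) * F :=
        mul_le_mul_of_nonneg_right hw hF0
    _ = _ := by ring

/-- **THE COMMUTATOR SOURCE**: `|([H,χ]Gf)(z)| ≤ e^{δ|x−z|/n}·((80(d+1) + A₊)·c·e^{3δ}·dfac·F)`; it vanishes off
the collar (there `χ ≡ 1` on the point, its neighbours and its block), and on the collar the three terms of
`comm_eq'` are bounded by (C1)·`deriv_pt`, (C2)·`value_pt` and `(a/n^{d+1})·n^{d+1}·value_pt`. [folklore] -/
theorem comm_pt (hn : 2 ≤ n) (hs : Fits M M0 s) (hM : ∀ i, 1 ≤ M i) {A Ab m2 δ c : ℝ} (hA : 0 ≤ A)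
    (hAb : A ≤ Ab) (hδ : 0 ≤ δ) (hc : 0 ≤ c)
    (G : Matrix ↥(boxDom (fun i => n * M i)) ↥(boxDom (fun i => n * M i)) ℝ) (hS0 : ∀ z, roww δ n G z ≤ c)
    (hS1 : ∀ (μ : Fin (d + 1)) (z ze : ↥(boxDom (fun i => n * M i))), ze.1 = z.1 + Pi.single μ 1 →
      wsum δ n z (fun z' => (n : ℝ) * (G ze z' - G z z')) ≤ c)
    (f : ↥(boxDom (fun i => n * M i)) → ℝ) {F D Db Df : ℝ} (hF : ∀ z, |f z| ≤ F)
    (x : ↥(boxDom (fun i => n * M i)))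
    (hD : ∀ z'', f z'' ≠ 0 → D ≤ supNorm (x.1 - z''.1))
    (hDb : ∀ y : ↥(boxDom (fun i => n * M0 i)), (y.1 - fun i => (n : ℤ) * s i) ∉ boxDom (fun i => n * M i) →
      Db ≤ supNorm ((emb (hs.scale n) x).1 - y.1))
    (hDf : ∀ z'', f z'' ≠ 0 → ∀ y : ↥(boxDom (fun i => n * M0 i)),
      (y.1 - fun i => (n : ℤ) * s i) ∉ boxDom (fun i => n * M i) → Df ≤ supNorm ((emb (hs.scale n) z'').1 - y.1))
    (z : ↥(boxDom (fun i => n * M i))) :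
    |comm n A m2 M (fun z' => chi n M M0 s z'.1) (G *ᵥ f) z|
      ≤ Real.exp (δ * supNorm (x.1 - z.1) / n) *
        ((80 * ((d : ℝ) + 1) + Ab) * c * Real.exp (3 * δ) * dfac (δ / 2) n D Db Df * F) := by
  have hn1 : 1 ≤ n := by omega
  have hF0 : 0 ≤ F := (abs_nonneg _).trans (hF x)
  set u := G *ᵥ f with hu
  set B := c * (Real.exp (3 * δ) * Real.exp (δ * supNorm (x.1 - z.1) / n) * dfac (δ / 2) n D Db Df) * F with hB
  have hB0 : 0 ≤ B := by
    rw [hB]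
    exact mul_nonneg (mul_nonneg hc (mul_nonneg (mul_nonneg (Real.exp_pos _).le (Real.exp_pos _).le)
      (dfac_pos _ _ _ _ _).le)) hF0
  have hRHS : Real.exp (δ * supNorm (x.1 - z.1) / n) *
        ((80 * ((d : ℝ) + 1) + Ab) * c * Real.exp (3 * δ) * dfac (δ / 2) n D Db Df * F)
      = (80 * ((d : ℝ) + 1) + Ab) * B := by rw [hB]; ring
  rw [hRHS]
  by_cases hbd : Bd n hs z
  · -- on the collar: the three terms
    rw [comm_eq']
    have hT1 : |∑ z' ∈ boxNbrs (fun i => n * M i) z,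
        (n : ℝ) * (chi n M M0 s z.1 - chi n M M0 s z'.1) * ((n : ℝ) * (u z' - u z))| ≤ 2 * ((d : ℝ) + 1) * (8 * B) := by
      calc |∑ z' ∈ boxNbrs (fun i => n * M i) z,
            (n : ℝ) * (chi n M M0 s z.1 - chi n M M0 s z'.1) * ((n : ℝ) * (u z' - u z))|
          ≤ ∑ z' ∈ boxNbrs (fun i => n * M i) z,
            |(n : ℝ) * (chi n M M0 s z.1 - chi n M M0 s z'.1) * ((n : ℝ) * (u z' - u z))| :=
            Finset.abs_sum_le_sum_abs _ _
        _ ≤ ∑ _z' ∈ boxNbrs (fun i => n * M i) z, 8 * B := by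
            refine Finset.sum_le_sum fun z' hz' => ?_
            have hzn : z'.1 ∈ nbrs z.1 := by
              unfold boxNbrs at hz'; rw [Finset.mem_filter] at hz'; exact hz'.2
            rw [abs_mul]
            exact mul_le_mul (abs_chi_sub_nbr_le n M M0 s z.2 z'.2 hzn)
              (deriv_pt hn1 hs hδ G hS1 f hF x hD hDb hDf hbd hz') (abs_nonneg _) (by norm_num)
        _ = (boxNbrs (fun i => n * M i) z).card * (8 * B) := by rw [Finset.sum_const, nsmul_eq_mul]
        _ ≤ 2 * ((d : ℝ) + 1) * (8 * B) := by
            refine mul_le_mul_of_nonneg_right ?_ (by positivity)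
            exact_mod_cast card_boxNbrs_le z
    have hT2 : |u z * ((n : ℝ) ^ 2 * ∑ z' ∈ boxNbrs (fun i => n * M i) z, (chi n M M0 s z.1 - chi n M M0 s z'.1))|
        ≤ B * (64 * ((d : ℝ) + 1)) := by
      rw [abs_mul]
      refine mul_le_mul ?_ (abs_lap_chi_le M M0 s hn hM z) (abs_nonneg _) hB0
      have := value_pt hn1 hs hδ G hS0 f hF x hD hDb hDf hbd
        (show supNorm (z.1 - z.1) ≤ n by rw [sub_self, supNorm_zero']; exact Nat.cast_nonneg n)
      rw [← hu] at this
      exact this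
    have hT3 : |A * ((n : ℝ) ^ (d + 1))⁻¹ *
        ∑ z' ∈ boxBlk n (fun i => n * M i) z, (chi n M M0 s z'.1 - chi n M M0 s z.1) * u z'| ≤ Ab * B := by
      have hn0 : (0 : ℝ) < (n : ℝ) ^ (d + 1) := by positivity
      rw [abs_mul, abs_of_nonneg (by positivity : (0 : ℝ) ≤ A * ((n : ℝ) ^ (d + 1))⁻¹)]
      calc A * ((n : ℝ) ^ (d + 1))⁻¹ *
            |∑ z' ∈ boxBlk n (fun i => n * M i) z, (chi n M M0 s z'.1 - chi n M M0 s z.1) * u z'|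
          ≤ A * ((n : ℝ) ^ (d + 1))⁻¹ * ∑ z' ∈ boxBlk n (fun i => n * M i) z, 1 * B := by
            refine mul_le_mul_of_nonneg_left ((Finset.abs_sum_le_sum_abs _ _).trans
              (Finset.sum_le_sum fun z' hz' => ?_)) (by positivity)
            rw [abs_mul]
            refine mul_le_mul ?_ ?_ (abs_nonneg _) zero_le_one
            · rw [abs_sub_le_iff]
              constructor <;> linarith [chi_nonneg n M M0 s z'.1, chi_le_one n M M0 s z'.1,
                chi_nonneg n M M0 s z.1, chi_le_one n M M0 s z.1]
            · have := value_pt hn1 hs hδ G hS0 f hF x hD hDb hDf hbd (supNorm_sub_le_of_boxBlk hn1 hz')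
              rw [← hu] at this
              exact this
        _ = A * B := by
            rw [Finset.sum_const, card_boxBlk_eq hn1 z, nsmul_eq_mul, one_mul]
            push_cast
            field_simp
        _ ≤ Ab * B := mul_le_mul_of_nonneg_right hAb hB0
    refine (abs_add_three _ _ _).trans ?_
    refine (add_le_add (add_le_add hT1 hT2) hT3).trans (le_of_eq ?_)
    ring
  · -- off the collar the commutator vanishes
    have h1 : ∀ z' : ↥(boxDom (fun i => n * M i)), supNorm (z.1 - z'.1) ≤ n → chi n M M0 s z'.1 = 1 :=
      fun z' hzz' => chi_eq_one_of_not_bd hn hs hM hzz' hbd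
    have hz1 : chi n M M0 s z.1 = 1 :=
      h1 z (by rw [sub_self, supNorm_zero']; exact Nat.cast_nonneg n)
    have h0 : comm n A m2 M (fun z' => chi n M M0 s z'.1) u z = 0 := by
      rw [comm_eq]
      rw [Finset.sum_eq_zero, Finset.sum_eq_zero]
      · ring
      · intro z' hz'
        rw [h1 z' (supNorm_sub_le_of_boxBlk hn1 hz'), hz1, sub_self, zero_mul]
      · intro z' hz'
        have hzn : z'.1 ∈ nbrs z.1 := by
          unfold boxNbrs at hz'; rw [Finset.mem_filter] at hz'; exact hz'.2
        rw [h1 z' ((supNorm_sub_le_one_of_mem_nbrs hzn).trans (by exact_mod_cast hn1)), hz1, sub_self, zero_mul]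
    rw [h0, abs_zero]
    exact mul_nonneg (add_nonneg (by positivity) (hA.trans hAb)) hB0

end Core

/-! ## §6 The core estimates: both clauses of (1.10) for `δG` with the factor (1.12), from the four row bounds -/

section Main

variable {n : ℕ} {M M0 : Fin (d + 1) → ℕ} {s : Fin (d + 1) → ℤ}

/-- **`δG_k(□, □₀, 0)f` at the inner fine point `x`**: `(H(□)⁻¹f)(x) − (H(□₀)⁻¹(Ef))(x + ns)`, `E` = extension by
zero (B4 (1.11) at `A = 0`, the outer Green's function applied to the source extended by zero and read off on `□`).
[cite: Balaban1983RegularityDecay, p. 573 (1.11)] -/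
def dG (n : ℕ) (A m2 : ℝ) {M M0 : Fin (d + 1) → ℕ} {s : Fin (d + 1) → ℤ} (hs : Fits M M0 s)
    (f : ↥(boxDom (fun i => n * M i)) → ℝ) (x : ↥(boxDom (fun i => n * M i))) : ℝ :=
  ((boxOpR n A m2 M)⁻¹ *ᵥ f) x - ((boxOpR n A m2 M0)⁻¹ *ᵥ ext n M M0 s f) (emb (hs.scale n) x)

/-- the constant of the core estimates: `c·e^{4δ}·(10 + (80(d+1) + A₊)c)`. [folklore] -/
def cCore (d : ℕ) (Ab δ c : ℝ) : ℝ := c * Real.exp (4 * δ) * (10 + (80 * ((d : ℝ) + 1) + Ab) * c)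

/-- `0 ≤ c_core` for `A₊ ≥ 0`, `c ≥ 0`. [folklore] -/
theorem cCore_nonneg (d : ℕ) {Ab δ c : ℝ} (hAb : 0 ≤ Ab) (hc : 0 ≤ c) : 0 ≤ cCore d Ab δ c := by
  unfold cCore
  have : 0 ≤ (80 * ((d : ℝ) + 1) + Ab) * c := mul_nonneg (add_nonneg (by positivity) hAb) hc
  exact mul_nonneg (mul_nonneg hc (Real.exp_pos _).le) (by linarith)

/-- a matrix–vector product entry as a sum. [folklore] -/
theorem mulVec_apply_eq {N : Fin (d + 1) → ℕ} (T : Matrix ↥(boxDom N) ↥(boxDom N) ℝ) (h : ↥(boxDom N) → ℝ)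
    (p : ↥(boxDom N)) : (T *ᵥ h) p = ∑ y, T p y * h y := rfl

/-- transporting a pointwise weighted bound on the inner box to the extension by zero. [folklore] -/
theorem ext_weight_bound (hs : Fits M M0 s) {δ Φ : ℝ} (hΦ : 0 ≤ Φ) (w : ↥(boxDom (fun i => n * M i)) → ℝ)
    (x : ↥(boxDom (fun i => n * M i)))
    (hw : ∀ z, |w z| ≤ Real.exp (δ * supNorm (x.1 - z.1) / n) * Φ) (y : ↥(boxDom (fun i => n * M0 i))) :
    |ext n M M0 s w y| ≤ Real.exp (δ * supNorm ((emb (hs.scale n) x).1 - y.1) / n) * Φ := by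
  by_cases hy : (y.1 - fun i => (n : ℤ) * s i) ∈ boxDom (fun i => n * M i)
  · have hyz : y = emb (hs.scale n) ⟨_, hy⟩ := (emb_of_mem hs hy).symm
    rw [hyz, ext_emb hs, emb_sub_emb hs]
    exact hw _
  · rw [ext_of_not_mem w hy, abs_zero]
    exact mul_nonneg (Real.exp_pos _).le hΦ

/-- **CORE, VALUE CLAUSE.**  From the weighted row bounds of `G = H(□)⁻¹` (values and differences) and of
`G₀ = H(□₀)⁻¹` (values): `|δG f(x)| ≤ c_core · e^{−(δ/2)D/n} e^{−((δ/2)D_b + (δ/2)D_f)/n} · F` whenever `|f| ≤ F`,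
`D ≤ |x − supp f|_∞`, `D_b ≤ |x + ns − (X₀∖(X + ns))|_∞`, `D_f ≤ |supp f + ns − (X₀∖(X + ns))|_∞` (the mechanism is
elementary; the printed statement it serves is B4 (1.10)·(1.12) at `A = 0` for boxes, `delta112_zero_box_value`). [folklore] -/
theorem core_value (hn : 2 ≤ n) (hs : Fits M M0 s) (hM : ∀ i, 1 ≤ M i) {A Ab m2 δ c : ℝ} (hA : 0 < A)
    (hAb : A ≤ Ab) (hm : 0 ≤ m2) (hδ : 0 ≤ δ) (hc : 0 ≤ c)
    (hS0 : ∀ z, roww δ n (boxOpR n A m2 M)⁻¹ z ≤ c)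
    (hS1 : ∀ (μ : Fin (d + 1)) (z ze : ↥(boxDom (fun i => n * M i))), ze.1 = z.1 + Pi.single μ 1 →
      wsum δ n z (fun z' => (n : ℝ) * ((boxOpR n A m2 M)⁻¹ ze z' - (boxOpR n A m2 M)⁻¹ z z')) ≤ c)
    (hR0 : ∀ y, roww δ n (boxOpR n A m2 M0)⁻¹ y ≤ c)
    (f : ↥(boxDom (fun i => n * M i)) → ℝ) {F D Db Df : ℝ} (hF : ∀ z, |f z| ≤ F)
    (x : ↥(boxDom (fun i => n * M i)))
    (hD : ∀ z'', f z'' ≠ 0 → D ≤ supNorm (x.1 - z''.1))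
    (hDb : ∀ y : ↥(boxDom (fun i => n * M0 i)), (y.1 - fun i => (n : ℤ) * s i) ∉ boxDom (fun i => n * M i) →
      Db ≤ supNorm ((emb (hs.scale n) x).1 - y.1))
    (hDf : ∀ z'', f z'' ≠ 0 → ∀ y : ↥(boxDom (fun i => n * M0 i)),
      (y.1 - fun i => (n : ℤ) * s i) ∉ boxDom (fun i => n * M i) → Df ≤ supNorm ((emb (hs.scale n) z'').1 - y.1)) :
    |dG n A m2 hs f x| ≤ cCore d Ab δ c * dfac (δ / 2) n D Db Df * F := by
  have hn1 : 1 ≤ n := by omega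
  have hF0 : 0 ≤ F := (abs_nonneg _).trans (hF x)
  set G := (boxOpR n A m2 M)⁻¹ with hG
  set G0 := (boxOpR n A m2 M0)⁻¹ with hG0
  set u := G *ᵥ f with hu
  set P := dfac (δ / 2) n D Db Df * F with hP
  have hP0 : 0 ≤ P := mul_nonneg (dfac_pos _ _ _ _ _).le hF0
  have hχ : ∀ z, (extNbrs n hs z).Nonempty → (fun z' => chi n M M0 s z'.1) z = 0 :=
    fun z hz => chi_eq_zero_of_extNbrs hn1 hs z hz
  have hdec := deltaG_decomp hn1 hA hm hs hM (fun z' => chi n M M0 s z'.1) hχ f x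
  unfold dG
  rw [← hG, ← hG0] at hdec ⊢
  rw [hdec]
  -- T1
  have hx0 : supNorm (x.1 - x.1) ≤ n := by rw [sub_self, supNorm_zero']; exact Nat.cast_nonneg n
  have hT1 : |(1 - chi n M M0 s x.1) * u x| ≤ c * Real.exp (3 * δ) * P := by
    by_cases hbd : Bd n hs x
    · have hv := value_pt hn1 hs hδ G hS0 f hF x hD hDb hDf hbd hx0
      rw [sub_self, supNorm_zero', mul_zero, zero_div, Real.exp_zero, mul_one, ← hu] at hv
      rw [abs_mul]
      calc |1 - chi n M M0 s x.1| * |u x| ≤ 1 * (c * (Real.exp (3 * δ) * dfac (δ / 2) n D Db Df) * F) :=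
            mul_le_mul (abs_one_sub_chi_le_one n M M0 s x.1) hv (abs_nonneg _) zero_le_one
        _ = c * Real.exp (3 * δ) * P := by rw [hP]; ring
    · rw [chi_eq_one_of_not_bd hn hs hM hx0 hbd, sub_self, zero_mul, abs_zero]
      exact mul_nonneg (mul_nonneg hc (Real.exp_pos _).le) hP0
  -- T2
  have hT2 : |(G0 *ᵥ ext n M M0 s (fun z => (1 - chi n M M0 s z.1) * f z)) (emb (hs.scale n) x)|
      ≤ c * (Real.exp δ * P) := by
    rw [mulVec_apply_eq]
    refine abs_sum_mul_le_of_weight n (emb (hs.scale n) x) (G0 (emb (hs.scale n) x)) _ (hR0 _)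
      (mul_nonneg (Real.exp_pos _).le hP0) fun y => ?_
    have := ext_weight_bound hs (mul_nonneg (Real.exp_pos δ).le hP0) (fun z => (1 - chi n M M0 s z.1) * f z) x
      (fun z => by have h := cutf_pt hn hs hM hδ f hF x hD hDb hDf z; rw [hP]; rw [mul_assoc] at h; exact h) y
    exact this
  -- T3
  have hT3 : |(G0 *ᵥ ext n M M0 s (comm n A m2 M (fun z' => chi n M M0 s z'.1) u)) (emb (hs.scale n) x)|
      ≤ c * ((80 * ((d : ℝ) + 1) + Ab) * c * Real.exp (3 * δ) * P) := by
    have hK : 0 ≤ (80 * ((d : ℝ) + 1) + Ab) * c := mul_nonneg (add_nonneg (by positivity) (hA.le.trans hAb)) hc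
    rw [mulVec_apply_eq]
    refine abs_sum_mul_le_of_weight n (emb (hs.scale n) x) (G0 (emb (hs.scale n) x)) _ (hR0 _)
      (mul_nonneg (mul_nonneg hK (Real.exp_pos _).le) hP0) fun y => ?_
    refine ext_weight_bound hs (mul_nonneg (mul_nonneg hK (Real.exp_pos _).le) hP0) _ x (fun z => ?_) y
    have h := comm_pt (m2 := m2) hn hs hM hA.le hAb hδ hc G hS0 hS1 f hF x hD hDb hDf z
    rw [← hu] at h
    rw [hP]
    calc |comm n A m2 M (fun z' => chi n M M0 s z'.1) u z|
        ≤ Real.exp (δ * supNorm (x.1 - z.1) / n) *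
          ((80 * ((d : ℝ) + 1) + Ab) * c * Real.exp (3 * δ) * dfac (δ / 2) n D Db Df * F) := h
      _ = _ := by ring
  -- assembly
  have he1 : Real.exp δ ≤ Real.exp (4 * δ) := Real.exp_le_exp.2 (by linarith)
  have he3 : Real.exp (3 * δ) ≤ Real.exp (4 * δ) := Real.exp_le_exp.2 (by linarith)
  have hK : 0 ≤ (80 * ((d : ℝ) + 1) + Ab) * c := mul_nonneg (add_nonneg (by positivity) (hA.le.trans hAb)) hc
  calc |(1 - chi n M M0 s x.1) * u x
        - (G0 *ᵥ ext n M M0 s (fun z => (1 - chi n M M0 s z.1) * f z)) (emb (hs.scale n) x)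
        + (G0 *ᵥ ext n M M0 s (comm n A m2 M (fun z' => chi n M M0 s z'.1) u)) (emb (hs.scale n) x)|
      ≤ |(1 - chi n M M0 s x.1) * u x|
        + |(G0 *ᵥ ext n M M0 s (fun z => (1 - chi n M M0 s z.1) * f z)) (emb (hs.scale n) x)|
        + |(G0 *ᵥ ext n M M0 s (comm n A m2 M (fun z' => chi n M M0 s z'.1) u)) (emb (hs.scale n) x)| := by
        refine (abs_add_le _ _).trans (add_le_add (abs_sub _ _) le_rfl)
    _ ≤ c * Real.exp (3 * δ) * P + c * (Real.exp δ * P) + c * ((80 * ((d : ℝ) + 1) + Ab) * c * Real.exp (3 * δ) * P) :=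
        add_le_add (add_le_add hT1 hT2) hT3
    _ ≤ c * Real.exp (4 * δ) * P + c * (Real.exp (4 * δ) * P)
        + c * ((80 * ((d : ℝ) + 1) + Ab) * c * Real.exp (4 * δ) * P) := by
        refine add_le_add (add_le_add ?_ ?_) ?_
        · exact mul_le_mul_of_nonneg_right (mul_le_mul_of_nonneg_left he3 hc) hP0
        · exact mul_le_mul_of_nonneg_left (mul_le_mul_of_nonneg_right he1 hP0) hc
        · exact mul_le_mul_of_nonneg_left (mul_le_mul_of_nonneg_right (mul_le_mul_of_nonneg_left he3 hK) hP0) hc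
    _ = c * Real.exp (4 * δ) * (2 + (80 * ((d : ℝ) + 1) + Ab) * c) * P := by ring
    _ ≤ c * Real.exp (4 * δ) * (10 + (80 * ((d : ℝ) + 1) + Ab) * c) * P :=
        mul_le_mul_of_nonneg_right (mul_le_mul_of_nonneg_left (by linarith) (mul_nonneg hc (Real.exp_pos _).le)) hP0
    _ = cCore d Ab δ c * dfac (δ / 2) n D Db Df * F := by rw [hP, cCore]; ring

/-- **CORE, DERIVATIVE CLAUSE.**  With the weighted differenced-row bound of `G₀` in place of its row bound:
`|n(δG f(x + e_μ) − δG f(x))| ≤ c_core · e^{−(δ/2)D/n} e^{−((δ/2)D_b + (δ/2)D_f)/n} · F` for every inner fine point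
`x` with `x + e_μ` inner (distances measured from `x`; the printed statement it serves is B4 (1.10)·(1.12) at `A = 0`
for boxes, `delta112_zero_box_deriv`). [folklore] -/
theorem core_deriv (hn : 2 ≤ n) (hs : Fits M M0 s) (hM : ∀ i, 1 ≤ M i) {A Ab m2 δ c : ℝ} (hA : 0 < A)
    (hAb : A ≤ Ab) (hm : 0 ≤ m2) (hδ : 0 ≤ δ) (hc : 0 ≤ c)
    (hS0 : ∀ z, roww δ n (boxOpR n A m2 M)⁻¹ z ≤ c)
    (hS1 : ∀ (μ : Fin (d + 1)) (z ze : ↥(boxDom (fun i => n * M i))), ze.1 = z.1 + Pi.single μ 1 →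
      wsum δ n z (fun z' => (n : ℝ) * ((boxOpR n A m2 M)⁻¹ ze z' - (boxOpR n A m2 M)⁻¹ z z')) ≤ c)
    (hR1 : ∀ (μ : Fin (d + 1)) (y ye : ↥(boxDom (fun i => n * M0 i))), ye.1 = y.1 + Pi.single μ 1 →
      wsum δ n y (fun y' => (n : ℝ) * ((boxOpR n A m2 M0)⁻¹ ye y' - (boxOpR n A m2 M0)⁻¹ y y')) ≤ c)
    (f : ↥(boxDom (fun i => n * M i)) → ℝ) {F D Db Df : ℝ} (hF : ∀ z, |f z| ≤ F)
    (μ : Fin (d + 1)) (x xe : ↥(boxDom (fun i => n * M i))) (hxe : xe.1 = x.1 + Pi.single μ 1)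
    (hD : ∀ z'', f z'' ≠ 0 → D ≤ supNorm (x.1 - z''.1))
    (hDb : ∀ y : ↥(boxDom (fun i => n * M0 i)), (y.1 - fun i => (n : ℤ) * s i) ∉ boxDom (fun i => n * M i) →
      Db ≤ supNorm ((emb (hs.scale n) x).1 - y.1))
    (hDf : ∀ z'', f z'' ≠ 0 → ∀ y : ↥(boxDom (fun i => n * M0 i)),
      (y.1 - fun i => (n : ℤ) * s i) ∉ boxDom (fun i => n * M i) → Df ≤ supNorm ((emb (hs.scale n) z'').1 - y.1)) :
    |(n : ℝ) * (dG n A m2 hs f xe - dG n A m2 hs f x)| ≤ cCore d Ab δ c * dfac (δ / 2) n D Db Df * F := by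
  have hn1 : 1 ≤ n := by omega
  have hF0 : 0 ≤ F := (abs_nonneg _).trans (hF x)
  set G := (boxOpR n A m2 M)⁻¹ with hG
  set G0 := (boxOpR n A m2 M0)⁻¹ with hG0
  set u := G *ᵥ f with hu
  set P := dfac (δ / 2) n D Db Df * F with hP
  have hP0 : 0 ≤ P := mul_nonneg (dfac_pos _ _ _ _ _).le hF0
  have hχ : ∀ z, (extNbrs n hs z).Nonempty → (fun z' => chi n M M0 s z'.1) z = 0 :=
    fun z hz => chi_eq_zero_of_extNbrs hn1 hs z hz
  have hdec := deltaG_decomp hn1 hA hm hs hM (fun z' => chi n M M0 s z'.1) hχ f x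
  have hdece := deltaG_decomp hn1 hA hm hs hM (fun z' => chi n M M0 s z'.1) hχ f xe
  unfold dG
  rw [← hG, ← hG0] at hdec hdece ⊢
  rw [hdec, hdece]
  have hxe' : (emb (hs.scale n) xe).1 = (emb (hs.scale n) x).1 + Pi.single μ 1 := by
    rw [emb_val, emb_val, hxe]; abel
  have hx0 : supNorm (x.1 - x.1) ≤ n := by rw [sub_self, supNorm_zero']; exact Nat.cast_nonneg n
  have hxxe : supNorm (x.1 - xe.1) ≤ n := by
    rw [hxe, show x.1 - (x.1 + Pi.single μ 1) = -(Pi.single μ (1 : ℤ) : Fin (d + 1) → ℤ) by abel, supNorm_neg]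
    exact (supNorm_single_le μ).trans (by exact_mod_cast hn1)
  have hxen : xe ∈ boxNbrs (fun i => n * M i) x := by
    unfold boxNbrs
    rw [Finset.mem_filter]
    exact ⟨Finset.mem_univ _, mem_nbrs.2 ⟨μ, Or.inl hxe⟩⟩
  -- T1
  have hT1 : |(n : ℝ) * ((1 - chi n M M0 s xe.1) * u xe - (1 - chi n M M0 s x.1) * u x)|
      ≤ 9 * (c * Real.exp (3 * δ) * P) := by
    by_cases hbd : Bd n hs x
    · have hv := value_pt hn1 hs hδ G hS0 f hF x hD hDb hDf hbd hx0
      rw [sub_self, supNorm_zero', mul_zero, zero_div, Real.exp_zero, mul_one, ← hu] at hv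
      have hd := deriv_pt hn1 hs hδ G hS1 f hF x hD hDb hDf hbd hxen
      rw [sub_self, supNorm_zero', mul_zero, zero_div, Real.exp_zero, mul_one, ← hu] at hd
      have hc1 := abs_chi_sub_nbr_le n M M0 s x.2 xe.2 (mem_nbrs.2 ⟨μ, Or.inl hxe⟩)
      have e : (n : ℝ) * ((1 - chi n M M0 s xe.1) * u xe - (1 - chi n M M0 s x.1) * u x)
          = (1 - chi n M M0 s xe.1) * ((n : ℝ) * (u xe - u x)) + (n : ℝ) * (chi n M M0 s x.1 - chi n M M0 s xe.1) * u x := by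
        ring
      rw [e]
      calc |(1 - chi n M M0 s xe.1) * ((n : ℝ) * (u xe - u x)) + (n : ℝ) * (chi n M M0 s x.1 - chi n M M0 s xe.1) * u x|
          ≤ |1 - chi n M M0 s xe.1| * |(n : ℝ) * (u xe - u x)| + |(n : ℝ) * (chi n M M0 s x.1 - chi n M M0 s xe.1)| * |u x| := by
            refine (abs_add_le _ _).trans (le_of_eq ?_)
            rw [abs_mul (1 - chi n M M0 s xe.1) ((n : ℝ) * (u xe - u x)),
              abs_mul ((n : ℝ) * (chi n M M0 s x.1 - chi n M M0 s xe.1)) (u x)]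
        _ ≤ 1 * (c * (Real.exp (3 * δ) * dfac (δ / 2) n D Db Df) * F)
            + 8 * (c * (Real.exp (3 * δ) * dfac (δ / 2) n D Db Df) * F) :=
            add_le_add (mul_le_mul (abs_one_sub_chi_le_one n M M0 s xe.1) hd (abs_nonneg _) zero_le_one)
              (mul_le_mul hc1 hv (abs_nonneg _) (by norm_num))
        _ = 9 * (c * Real.exp (3 * δ) * P) := by rw [hP]; ring
    · rw [chi_eq_one_of_not_bd hn hs hM hx0 hbd, chi_eq_one_of_not_bd hn hs hM hxxe hbd]
      rw [sub_self, zero_mul, zero_mul, sub_zero, mul_zero, abs_zero]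
      exact mul_nonneg (by norm_num) (mul_nonneg (mul_nonneg hc (Real.exp_pos _).le) hP0)
  -- T2
  have hT2 : |(n : ℝ) * ((G0 *ᵥ ext n M M0 s (fun z => (1 - chi n M M0 s z.1) * f z)) (emb (hs.scale n) xe)
        - (G0 *ᵥ ext n M M0 s (fun z => (1 - chi n M M0 s z.1) * f z)) (emb (hs.scale n) x))|
      ≤ c * (Real.exp δ * P) := by
    rw [mulVec_sub_mulVec]
    refine abs_sum_mul_le_of_weight n (emb (hs.scale n) x) _ _ (hR1 μ _ _ hxe')
      (mul_nonneg (Real.exp_pos _).le hP0) fun y => ?_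
    exact ext_weight_bound hs (mul_nonneg (Real.exp_pos δ).le hP0) (fun z => (1 - chi n M M0 s z.1) * f z) x
      (fun z => by have h := cutf_pt hn hs hM hδ f hF x hD hDb hDf z; rw [hP]; rw [mul_assoc] at h; exact h) y
  -- T3
  have hK : 0 ≤ (80 * ((d : ℝ) + 1) + Ab) * c := mul_nonneg (add_nonneg (by positivity) (hA.le.trans hAb)) hc
  have hT3 : |(n : ℝ) * ((G0 *ᵥ ext n M M0 s (comm n A m2 M (fun z' => chi n M M0 s z'.1) u)) (emb (hs.scale n) xe)
        - (G0 *ᵥ ext n M M0 s (comm n A m2 M (fun z' => chi n M M0 s z'.1) u)) (emb (hs.scale n) x))|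
      ≤ c * ((80 * ((d : ℝ) + 1) + Ab) * c * Real.exp (3 * δ) * P) := by
    rw [mulVec_sub_mulVec]
    refine abs_sum_mul_le_of_weight n (emb (hs.scale n) x) _ _ (hR1 μ _ _ hxe')
      (mul_nonneg (mul_nonneg hK (Real.exp_pos _).le) hP0) fun y => ?_
    refine ext_weight_bound hs (mul_nonneg (mul_nonneg hK (Real.exp_pos _).le) hP0) _ x (fun z => ?_) y
    have h := comm_pt (m2 := m2) hn hs hM hA.le hAb hδ hc G hS0 hS1 f hF x hD hDb hDf z
    rw [← hu] at h
    rw [hP]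
    calc |comm n A m2 M (fun z' => chi n M M0 s z'.1) u z|
        ≤ Real.exp (δ * supNorm (x.1 - z.1) / n) *
          ((80 * ((d : ℝ) + 1) + Ab) * c * Real.exp (3 * δ) * dfac (δ / 2) n D Db Df * F) := h
      _ = _ := by ring
  -- assembly
  have he1 : Real.exp δ ≤ Real.exp (4 * δ) := Real.exp_le_exp.2 (by linarith)
  have he3 : Real.exp (3 * δ) ≤ Real.exp (4 * δ) := Real.exp_le_exp.2 (by linarith)
  set a1 := (1 - chi n M M0 s xe.1) * u xe with ha1
  set a0 := (1 - chi n M M0 s x.1) * u x with ha0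
  set b1 := (G0 *ᵥ ext n M M0 s (fun z => (1 - chi n M M0 s z.1) * f z)) (emb (hs.scale n) xe) with hb1
  set b0 := (G0 *ᵥ ext n M M0 s (fun z => (1 - chi n M M0 s z.1) * f z)) (emb (hs.scale n) x) with hb0
  set c1 := (G0 *ᵥ ext n M M0 s (comm n A m2 M (fun z' => chi n M M0 s z'.1) u)) (emb (hs.scale n) xe) with hc1'
  set c0 := (G0 *ᵥ ext n M M0 s (comm n A m2 M (fun z' => chi n M M0 s z'.1) u)) (emb (hs.scale n) x) with hc0'
  have e : (n : ℝ) * (a1 - b1 + c1 - (a0 - b0 + c0))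
      = (n : ℝ) * (a1 - a0) - (n : ℝ) * (b1 - b0) + (n : ℝ) * (c1 - c0) := by ring
  rw [e]
  calc |(n : ℝ) * (a1 - a0) - (n : ℝ) * (b1 - b0) + (n : ℝ) * (c1 - c0)|
      ≤ |(n : ℝ) * (a1 - a0)| + |(n : ℝ) * (b1 - b0)| + |(n : ℝ) * (c1 - c0)| :=
        (abs_add_le _ _).trans (add_le_add (abs_sub _ _) le_rfl)
    _ ≤ 9 * (c * Real.exp (3 * δ) * P) + c * (Real.exp δ * P)
        + c * ((80 * ((d : ℝ) + 1) + Ab) * c * Real.exp (3 * δ) * P) := add_le_add (add_le_add hT1 hT2) hT3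
    _ ≤ 9 * (c * Real.exp (4 * δ) * P) + c * (Real.exp (4 * δ) * P)
        + c * ((80 * ((d : ℝ) + 1) + Ab) * c * Real.exp (4 * δ) * P) := by
        refine add_le_add (add_le_add ?_ ?_) ?_
        · exact mul_le_mul_of_nonneg_left (mul_le_mul_of_nonneg_right (mul_le_mul_of_nonneg_left he3 hc) hP0)
            (by norm_num)
        · exact mul_le_mul_of_nonneg_left (mul_le_mul_of_nonneg_right he1 hP0) hc
        · exact mul_le_mul_of_nonneg_left (mul_le_mul_of_nonneg_right (mul_le_mul_of_nonneg_left he3 hK) hP0) hc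
    _ = cCore d Ab δ c * dfac (δ / 2) n D Db Df * F := by rw [hP, cCore]; ring

end Main

/-! ## §7 B4 (1.11)–(1.12) at `A = 0` for nested block-aligned boxes: both clauses of (1.10) with the factor (1.12) -/

section Final

/-- `0 < c_core` for `A₊ ≥ 0`, `c > 0`. [folklore] -/
theorem cCore_pos (d : ℕ) {Ab δ c : ℝ} (hAb : 0 ≤ Ab) (hc : 0 < c) : 0 < cCore d Ab δ c := by
  unfold cCore
  have : 0 ≤ (80 * ((d : ℝ) + 1) + Ab) * c := mul_nonneg (add_nonneg (by positivity) hAb) hc.le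
  exact mul_pos (mul_pos hc (Real.exp_pos _)) (by linarith)

/-- the weighted row functional is monotone in the rate. [folklore] -/
theorem roww_rate_mono {N : Fin (d + 1) → ℕ} {δ δ' : ℝ} (h : δ ≤ δ') (n : ℕ)
    (T : Matrix ↥(boxDom N) ↥(boxDom N) ℝ) (x : ↥(boxDom N)) : roww δ n T x ≤ roww δ' n T x := by
  unfold roww
  refine Finset.sum_le_sum fun x' _ => mul_le_mul_of_nonneg_left (Real.exp_le_exp.2 ?_) (abs_nonneg _)
  exact div_le_div_of_nonneg_right (mul_le_mul_of_nonneg_right h (supNorm_nonneg _)) (Nat.cast_nonneg n)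

/-- the weighted functional of a vector is monotone in the rate. [folklore] -/
theorem wsum_rate_mono {N : Fin (d + 1) → ℕ} {δ δ' : ℝ} (h : δ ≤ δ') (n : ℕ) (x : ↥(boxDom N))
    (g : ↥(boxDom N) → ℝ) : wsum δ n x g ≤ wsum δ' n x g := by
  unfold wsum
  refine Finset.sum_le_sum fun x' _ => mul_le_mul_of_nonneg_left (Real.exp_le_exp.2 ?_) (abs_nonneg _)
  exact div_le_div_of_nonneg_right (mul_le_mul_of_nonneg_right h (supNorm_nonneg _)) (Nat.cast_nonneg n)

/-- **MERGING THE TWO ROW BOUNDS OF (1.10) AT `A = 0`** (values: node `B4Thm110ZeroBox`; differences: node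
`B4Thm110ZeroBoxDeriv`) at a common rate `δ = min` and height `c = max`, for a coefficient `coef a k` of `P_k`
(`a_k = B1.aSeq a L k`, or the literal `a`). [folklore] -/
theorem bounds_common {d ℓ : ℕ} {amin aplus m2plus : ℝ} (coef : ℝ → ℕ → ℝ)
    (h6 : ∃ δ₀ c₀ : ℝ, 0 < δ₀ ∧ 0 < c₀ ∧ ∀ (k : ℕ), 1 ≤ k → ∀ (a m2 : ℝ), amin ≤ a → a ≤ aplus → 0 ≤ m2 →
      m2 ≤ m2plus → ∀ (M : Fin (d + 1) → ℕ), (∀ i, 1 ≤ M i) →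
        ∀ x : ↥(boxDom (fun i => (ℓ + 1) ^ k * M i)),
          ∑ x', |(boxOpR ((ℓ + 1) ^ k) (coef a k) m2 M)⁻¹ x x'|
              * Real.exp (δ₀ * supNorm (x.1 - x'.1) / (((ℓ + 1) ^ k : ℕ) : ℝ)) ≤ c₀)
    (h7 : ∃ δ₀ c₀ : ℝ, 0 < δ₀ ∧ 0 < c₀ ∧ ∀ (k : ℕ), 1 ≤ k → ∀ (a m2 : ℝ), amin ≤ a → a ≤ aplus → 0 ≤ m2 →
      m2 ≤ m2plus → ∀ (M : Fin (d + 1) → ℕ), (∀ i, 1 ≤ M i) →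
        ∀ (μ : Fin (d + 1)) (x xe : ↥(boxDom (fun i => (ℓ + 1) ^ k * M i))), xe.1 = x.1 + Pi.single μ 1 →
          ∑ x', |(((ℓ + 1) ^ k : ℕ) : ℝ) *
                ((boxOpR ((ℓ + 1) ^ k) (coef a k) m2 M)⁻¹ xe x' - (boxOpR ((ℓ + 1) ^ k) (coef a k) m2 M)⁻¹ x x')|
              * Real.exp (δ₀ * supNorm (x.1 - x'.1) / (((ℓ + 1) ^ k : ℕ) : ℝ)) ≤ c₀) :
    ∃ δ c : ℝ, 0 < δ ∧ 0 < c ∧ ∀ (k : ℕ), 1 ≤ k → ∀ (a m2 : ℝ), amin ≤ a → a ≤ aplus → 0 ≤ m2 → m2 ≤ m2plus →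
      ∀ (M : Fin (d + 1) → ℕ), (∀ i, 1 ≤ M i) →
        (∀ x : ↥(boxDom (fun i => (ℓ + 1) ^ k * M i)),
          roww δ ((ℓ + 1) ^ k) (boxOpR ((ℓ + 1) ^ k) (coef a k) m2 M)⁻¹ x ≤ c) ∧
        (∀ (μ : Fin (d + 1)) (x xe : ↥(boxDom (fun i => (ℓ + 1) ^ k * M i))), xe.1 = x.1 + Pi.single μ 1 →
          wsum δ ((ℓ + 1) ^ k) x (fun x' => (((ℓ + 1) ^ k : ℕ) : ℝ) *
            ((boxOpR ((ℓ + 1) ^ k) (coef a k) m2 M)⁻¹ xe x' - (boxOpR ((ℓ + 1) ^ k) (coef a k) m2 M)⁻¹ x x')) ≤ c) := by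
  obtain ⟨δ₆, c₆, hδ6, hc6, H6⟩ := h6
  obtain ⟨δ₇, c₇, hδ7, hc7, H7⟩ := h7
  refine ⟨min δ₆ δ₇, max c₆ c₇, lt_min hδ6 hδ7, lt_max_iff.2 (Or.inl hc6), ?_⟩
  intro k hk a m2 h1 h2 h3 h4 M hM
  refine ⟨fun x => ?_, fun μ x xe hxe => ?_⟩
  · calc roww (min δ₆ δ₇) ((ℓ + 1) ^ k) (boxOpR ((ℓ + 1) ^ k) (coef a k) m2 M)⁻¹ x
        ≤ roww δ₆ ((ℓ + 1) ^ k) (boxOpR ((ℓ + 1) ^ k) (coef a k) m2 M)⁻¹ x := roww_rate_mono (min_le_left _ _) _ _ _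
      _ ≤ c₆ := H6 k hk a m2 h1 h2 h3 h4 M hM x
      _ ≤ max c₆ c₇ := le_max_left _ _
  · calc wsum (min δ₆ δ₇) ((ℓ + 1) ^ k) x (fun x' => (((ℓ + 1) ^ k : ℕ) : ℝ) *
            ((boxOpR ((ℓ + 1) ^ k) (coef a k) m2 M)⁻¹ xe x' - (boxOpR ((ℓ + 1) ^ k) (coef a k) m2 M)⁻¹ x x'))
        ≤ wsum δ₇ ((ℓ + 1) ^ k) x (fun x' => (((ℓ + 1) ^ k : ℕ) : ℝ) *
            ((boxOpR ((ℓ + 1) ^ k) (coef a k) m2 M)⁻¹ xe x' - (boxOpR ((ℓ + 1) ^ k) (coef a k) m2 M)⁻¹ x x')) :=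
          wsum_rate_mono (min_le_right _ _) _ _ _
      _ ≤ c₇ := H7 k hk a m2 h1 h2 h3 h4 M hM μ x xe hxe
      _ ≤ max c₆ c₇ := le_max_right _ _

/-- `L^k ≥ 2` for `L ≥ 2`, `k ≥ 1`. [folklore] -/
theorem two_le_pow {ℓ k : ℕ} (hℓ : 1 ≤ ℓ) (hk : 1 ≤ k) : 2 ≤ (ℓ + 1) ^ k :=
  le_trans (by omega) (Nat.le_self_pow (by omega) (ℓ + 1))

/-- **THE ENGINE**: both printed clauses for `δG` from the merged row bounds, for any admissible coefficient.
[folklore] -/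
theorem delta112_of_bounds {d ℓ : ℕ} (hℓ : 1 ≤ ℓ) {amin aplus m2plus Ab : ℝ} (coef : ℝ → ℕ → ℝ)
    (hcoef : ∀ (k : ℕ), 1 ≤ k → ∀ a, amin ≤ a → a ≤ aplus → 0 < coef a k ∧ coef a k ≤ Ab)
    {δ c : ℝ} (hδ : 0 < δ) (hc : 0 < c)
    (H : ∀ (k : ℕ), 1 ≤ k → ∀ (a m2 : ℝ), amin ≤ a → a ≤ aplus → 0 ≤ m2 → m2 ≤ m2plus →
      ∀ (M : Fin (d + 1) → ℕ), (∀ i, 1 ≤ M i) →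
        (∀ x : ↥(boxDom (fun i => (ℓ + 1) ^ k * M i)),
          roww δ ((ℓ + 1) ^ k) (boxOpR ((ℓ + 1) ^ k) (coef a k) m2 M)⁻¹ x ≤ c) ∧
        (∀ (μ : Fin (d + 1)) (x xe : ↥(boxDom (fun i => (ℓ + 1) ^ k * M i))), xe.1 = x.1 + Pi.single μ 1 →
          wsum δ ((ℓ + 1) ^ k) x (fun x' => (((ℓ + 1) ^ k : ℕ) : ℝ) *
            ((boxOpR ((ℓ + 1) ^ k) (coef a k) m2 M)⁻¹ xe x' - (boxOpR ((ℓ + 1) ^ k) (coef a k) m2 M)⁻¹ x x')) ≤ c)) :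
    ∀ (k : ℕ), 1 ≤ k → ∀ (a m2 : ℝ), amin ≤ a → a ≤ aplus → 0 ≤ m2 →
      m2 ≤ m2plus → ∀ (M M0 : Fin (d + 1) → ℕ) (s : Fin (d + 1) → ℤ) (hs : Fits M M0 s), (∀ i, 1 ≤ M i) →
      ∀ (f : ↥(boxDom (fun i => (ℓ + 1) ^ k * M i)) → ℝ) (F : ℝ), (∀ z, |f z| ≤ F) →
      ∀ (x : ↥(boxDom (fun i => (ℓ + 1) ^ k * M i))) (D Db Df : ℝ),
        (∀ z, f z ≠ 0 → D ≤ supNorm (x.1 - z.1)) →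
        (∀ y : ↥(boxDom (fun i => (ℓ + 1) ^ k * M0 i)),
          (y.1 - fun i => ((((ℓ + 1) ^ k : ℕ) : ℤ)) * s i) ∉ boxDom (fun i => (ℓ + 1) ^ k * M i) →
            Db ≤ supNorm ((emb (hs.scale ((ℓ + 1) ^ k)) x).1 - y.1)) →
        (∀ z, f z ≠ 0 → ∀ y : ↥(boxDom (fun i => (ℓ + 1) ^ k * M0 i)),
          (y.1 - fun i => ((((ℓ + 1) ^ k : ℕ) : ℤ)) * s i) ∉ boxDom (fun i => (ℓ + 1) ^ k * M i) →
            Df ≤ supNorm ((emb (hs.scale ((ℓ + 1) ^ k)) z).1 - y.1)) →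
        |dG ((ℓ + 1) ^ k) (coef a k) m2 hs f x|
            ≤ cCore d Ab δ c * dfac (δ / 2) ((ℓ + 1) ^ k) D Db Df * F ∧
        ∀ (μ : Fin (d + 1)) (xe : ↥(boxDom (fun i => (ℓ + 1) ^ k * M i))), xe.1 = x.1 + Pi.single μ 1 →
          |(((ℓ + 1) ^ k : ℕ) : ℝ) * (dG ((ℓ + 1) ^ k) (coef a k) m2 hs f xe - dG ((ℓ + 1) ^ k) (coef a k) m2 hs f x)|
            ≤ cCore d Ab δ c * dfac (δ / 2) ((ℓ + 1) ^ k) D Db Df * F := by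
  intro k hk a m2 h1 h2 h3 h4 M M0 s hs hM f F hF x D Db Df hD hDb hDf
  have hn : 2 ≤ (ℓ + 1) ^ k := two_le_pow hℓ hk
  obtain ⟨hA0, hA2⟩ := hcoef k hk a h1 h2
  have hM0 : ∀ i, 1 ≤ M0 i := hs.one_le hM
  obtain ⟨hS0, hS1⟩ := H k hk a m2 h1 h2 h3 h4 M hM
  obtain ⟨hR0, hR1⟩ := H k hk a m2 h1 h2 h3 h4 M0 hM0
  exact ⟨core_value hn hs hM hA0 hA2 h3 hδ.le hc.le hS0 hS1 hR0 f hF x hD hDb hDf,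
    fun μ xe hxe => core_deriv hn hs hM hA0 hA2 h3 hδ.le hc.le hS0 hS1 hR1 f hF μ x xe hxe hD hDb hDf⟩

/-- **B4 (1.11)–(1.12) AT `A = 0` FOR NESTED BOXES — THE VALUE CLAUSE OF (1.10) WITH THE FACTOR (1.12).**
There are `δ₀ > 0`, `c₀ > 0` depending only on `d`, `L = ℓ + 1` and the window such that for every `k ≥ 1`
(`η = L^{-k}`, `n = L^k` fine points per unit length), every `(a, m²)` in the window, every nested pair of block-aligned
rectangular parallelepipeds `Ω = s + Π_μ[0, M_μ) ⊂ Ω₀ = Π_μ[0, M₀_μ)` (`M_μ ≥ 1`, integer corners), every function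
`f` on the fine points of `Ω` with `|f| ≤ F`, every fine point `x ∈ Ω` and all `D, D_b, D_f` with
`D ≤ |x − supp f|_∞`, `D_b ≤ |x − (Ω₀∖Ω)|_∞`, `D_f ≤ |supp f − (Ω₀∖Ω)|_∞` (fine-lattice sup-distances; `Ω₀∖Ω` is the
part of `Ω^c` seen by `G_k(Ω₀, 0)`):
`|(δG_k(Ω, Ω₀, 0)f)(x)| ≤ c₀ · e^{−δ₀D/n} · e^{−δ₀D_b/n − δ₀D_f/n} · F`,
`δG_k(Ω, Ω₀, 0)f = G_k(Ω, 0)f − (G_k(Ω₀, 0)Ef)|_Ω` (1.11), `G_k(·, 0) = (−Δ^{η,N} + m² + a_kP_k)^{-1}` the propagator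
(1.9) in values form.  This is the value clause of (1.10) «with the additional factor (1.12)» in the typed reading
`exp(−δ₀dist(x, Ω^c) − δ₀dist(supp f, Ω^c))` of the twice-printed distance (D-b04.2), for boxes («if `Ω` is a
rectangular parallelepiped … the restriction `dist({x,x′}, Ω^c) ≥ R₀` is unnecessary», p. 579).  HONEST LABEL:
proved here, at `A = 0` and for block-aligned boxes only, by a smooth-cutoff commutator argument over the kernel
bounds of nodes `B4Thm110ZeroBox` / `B4Thm110ZeroBoxDeriv` — not a transcription of the print's random-walk proof
(p. 579). [cite: Balaban1983RegularityDecay, p. 573 Theorem (Prop. 2.1 of [1]) (1.10)–(1.12); p. 579] -/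
theorem delta112_zero_box_value (d ℓ : ℕ) (hℓ : 1 ≤ ℓ) (amin aplus m2plus : ℝ) (ha : 0 < amin) :
    ∃ δ₀ c₀ : ℝ, 0 < δ₀ ∧ 0 < c₀ ∧ ∀ (k : ℕ), 1 ≤ k → ∀ (a m2 : ℝ), amin ≤ a → a ≤ aplus → 0 ≤ m2 →
      m2 ≤ m2plus → ∀ (M M0 : Fin (d + 1) → ℕ) (s : Fin (d + 1) → ℤ) (hs : Fits M M0 s), (∀ i, 1 ≤ M i) →
      ∀ (f : ↥(boxDom (fun i => (ℓ + 1) ^ k * M i)) → ℝ) (F : ℝ), (∀ z, |f z| ≤ F) →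
      ∀ (x : ↥(boxDom (fun i => (ℓ + 1) ^ k * M i))) (D Db Df : ℝ),
        (∀ z, f z ≠ 0 → D ≤ supNorm (x.1 - z.1)) →
        (∀ y : ↥(boxDom (fun i => (ℓ + 1) ^ k * M0 i)),
          (y.1 - fun i => ((((ℓ + 1) ^ k : ℕ) : ℤ)) * s i) ∉ boxDom (fun i => (ℓ + 1) ^ k * M i) →
            Db ≤ supNorm ((emb (hs.scale ((ℓ + 1) ^ k)) x).1 - y.1)) →
        (∀ z, f z ≠ 0 → ∀ y : ↥(boxDom (fun i => (ℓ + 1) ^ k * M0 i)),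
          (y.1 - fun i => ((((ℓ + 1) ^ k : ℕ) : ℤ)) * s i) ∉ boxDom (fun i => (ℓ + 1) ^ k * M i) →
            Df ≤ supNorm ((emb (hs.scale ((ℓ + 1) ^ k)) z).1 - y.1)) →
        |dG ((ℓ + 1) ^ k) (B1.aSeq a ((ℓ : ℝ) + 1) k) m2 hs f x|
          ≤ c₀ * Real.exp (-(δ₀ * D / (((ℓ + 1) ^ k : ℕ) : ℝ)))
              * Real.exp (-(δ₀ * Db / (((ℓ + 1) ^ k : ℕ) : ℝ) + δ₀ * Df / (((ℓ + 1) ^ k : ℕ) : ℝ))) * F := by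
  obtain ⟨δ, c, hδ, hc, H⟩ := bounds_common (fun a k => B1.aSeq a ((ℓ : ℝ) + 1) k)
    (thm110_zero_box_roww d ℓ hℓ amin aplus m2plus ha) (thm110_zero_box_deriv_roww d ℓ hℓ amin aplus m2plus ha)
  have hAb : 0 ≤ max amin aplus := ha.le.trans (le_max_left _ _)
  refine ⟨δ / 2, cCore d (max amin aplus) δ c, half_pos hδ, cCore_pos d hAb hc, ?_⟩
  intro k hk a m2 h1 h2 h3 h4 M M0 s hs hM f F hF x D Db Df hD hDb hDf
  have hcoef : ∀ (k : ℕ), 1 ≤ k → ∀ a, amin ≤ a → a ≤ aplus →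
      0 < (fun a k => B1.aSeq a ((ℓ : ℝ) + 1) k) a k ∧ (fun a k => B1.aSeq a ((ℓ : ℝ) + 1) k) a k ≤ max amin aplus := by
    intro k hk a h1 h2
    obtain ⟨-, hA2, hA0⟩ := aSeq_window hℓ ha h1 h2 hk
    exact ⟨hA0, hA2.trans (le_max_right _ _)⟩
  have h := (delta112_of_bounds hℓ _ hcoef hδ hc H k hk a m2 h1 h2 h3 h4 M M0 s hs hM f F hF x D Db Df
    hD hDb hDf).1
  simpa only [dfac, mul_assoc] using h

/-- **B4 (1.11)–(1.12) AT `A = 0` FOR NESTED BOXES — THE DERIVATIVE CLAUSE OF (1.10) WITH THE FACTOR (1.12).**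
Same setting; for every axis `μ` and every pair of fine-lattice neighbours `x, x + ηe_μ` in `Ω` (distances measured
from `x`): `|η^{-1}((δG_k(Ω,Ω₀,0)f)(x + ηe_μ) − (δG_k(Ω,Ω₀,0)f)(x))| ≤ c₀ · e^{−δ₀D/n} · e^{−δ₀D_b/n − δ₀D_f/n} · F`,
`η^{-1}(φ(x + ηe_μ) − φ(x)) = (D^η_{0,μ}φ)(x)` the covariant derivative (1.3) at `A = 0`.  HONEST LABEL as for the
value clause. [cite: Balaban1983RegularityDecay, p. 573 Theorem (Prop. 2.1 of [1]) (1.10)–(1.12); p. 579] -/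
theorem delta112_zero_box_deriv (d ℓ : ℕ) (hℓ : 1 ≤ ℓ) (amin aplus m2plus : ℝ) (ha : 0 < amin) :
    ∃ δ₀ c₀ : ℝ, 0 < δ₀ ∧ 0 < c₀ ∧ ∀ (k : ℕ), 1 ≤ k → ∀ (a m2 : ℝ), amin ≤ a → a ≤ aplus → 0 ≤ m2 →
      m2 ≤ m2plus → ∀ (M M0 : Fin (d + 1) → ℕ) (s : Fin (d + 1) → ℤ) (hs : Fits M M0 s), (∀ i, 1 ≤ M i) →
      ∀ (f : ↥(boxDom (fun i => (ℓ + 1) ^ k * M i)) → ℝ) (F : ℝ), (∀ z, |f z| ≤ F) →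
      ∀ (μ : Fin (d + 1)) (x xe : ↥(boxDom (fun i => (ℓ + 1) ^ k * M i))), xe.1 = x.1 + Pi.single μ 1 →
      ∀ (D Db Df : ℝ),
        (∀ z, f z ≠ 0 → D ≤ supNorm (x.1 - z.1)) →
        (∀ y : ↥(boxDom (fun i => (ℓ + 1) ^ k * M0 i)),
          (y.1 - fun i => ((((ℓ + 1) ^ k : ℕ) : ℤ)) * s i) ∉ boxDom (fun i => (ℓ + 1) ^ k * M i) →
            Db ≤ supNorm ((emb (hs.scale ((ℓ + 1) ^ k)) x).1 - y.1)) →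
        (∀ z, f z ≠ 0 → ∀ y : ↥(boxDom (fun i => (ℓ + 1) ^ k * M0 i)),
          (y.1 - fun i => ((((ℓ + 1) ^ k : ℕ) : ℤ)) * s i) ∉ boxDom (fun i => (ℓ + 1) ^ k * M i) →
            Df ≤ supNorm ((emb (hs.scale ((ℓ + 1) ^ k)) z).1 - y.1)) →
        |(((ℓ + 1) ^ k : ℕ) : ℝ) * (dG ((ℓ + 1) ^ k) (B1.aSeq a ((ℓ : ℝ) + 1) k) m2 hs f xe
            - dG ((ℓ + 1) ^ k) (B1.aSeq a ((ℓ : ℝ) + 1) k) m2 hs f x)|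
          ≤ c₀ * Real.exp (-(δ₀ * D / (((ℓ + 1) ^ k : ℕ) : ℝ)))
              * Real.exp (-(δ₀ * Db / (((ℓ + 1) ^ k : ℕ) : ℝ) + δ₀ * Df / (((ℓ + 1) ^ k : ℕ) : ℝ))) * F := by
  obtain ⟨δ, c, hδ, hc, H⟩ := bounds_common (fun a k => B1.aSeq a ((ℓ : ℝ) + 1) k)
    (thm110_zero_box_roww d ℓ hℓ amin aplus m2plus ha) (thm110_zero_box_deriv_roww d ℓ hℓ amin aplus m2plus ha)
  have hAb : 0 ≤ max amin aplus := ha.le.trans (le_max_left _ _)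
  refine ⟨δ / 2, cCore d (max amin aplus) δ c, half_pos hδ, cCore_pos d hAb hc, ?_⟩
  intro k hk a m2 h1 h2 h3 h4 M M0 s hs hM f F hF μ x xe hxe D Db Df hD hDb hDf
  have hcoef : ∀ (k : ℕ), 1 ≤ k → ∀ a, amin ≤ a → a ≤ aplus →
      0 < (fun a k => B1.aSeq a ((ℓ : ℝ) + 1) k) a k ∧ (fun a k => B1.aSeq a ((ℓ : ℝ) + 1) k) a k ≤ max amin aplus := by
    intro k hk a h1 h2
    obtain ⟨-, hA2, hA0⟩ := aSeq_window hℓ ha h1 h2 hk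
    exact ⟨hA0, hA2.trans (le_max_right _ _)⟩
  have h := (delta112_of_bounds hℓ _ hcoef hδ hc H k hk a m2 h1 h2 h3 h4 M M0 s hs hM f F hF x D Db Df
    hD hDb hDf).2 μ xe hxe
  simpa only [dfac, mul_assoc] using h

/-! ### The same two clauses with the literal coefficient `a` of (1.6)

`G_k(·, 0) = (−Δ^{η,N} + m² + aP_k)^{-1}` with `a` itself ranging over the window (nodes 6/7, `_coeff` forms). -/

/-- the value clause of (1.10)·(1.12) for `δG` at `A = 0`, nested boxes, literal coefficient `a`.
[cite: Balaban1983RegularityDecay, p. 573 Theorem (Prop. 2.1 of [1]) (1.10)–(1.12) with (1.6) p. 572; p. 579] -/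
theorem delta112_zero_box_value_coeff (d ℓ : ℕ) (hℓ : 1 ≤ ℓ) (amin aplus m2plus : ℝ) (ha : 0 < amin) :
    ∃ δ₀ c₀ : ℝ, 0 < δ₀ ∧ 0 < c₀ ∧ ∀ (k : ℕ), 1 ≤ k → ∀ (a m2 : ℝ), amin ≤ a → a ≤ aplus → 0 ≤ m2 →
      m2 ≤ m2plus → ∀ (M M0 : Fin (d + 1) → ℕ) (s : Fin (d + 1) → ℤ) (hs : Fits M M0 s), (∀ i, 1 ≤ M i) →
      ∀ (f : ↥(boxDom (fun i => (ℓ + 1) ^ k * M i)) → ℝ) (F : ℝ), (∀ z, |f z| ≤ F) →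
      ∀ (x : ↥(boxDom (fun i => (ℓ + 1) ^ k * M i))) (D Db Df : ℝ),
        (∀ z, f z ≠ 0 → D ≤ supNorm (x.1 - z.1)) →
        (∀ y : ↥(boxDom (fun i => (ℓ + 1) ^ k * M0 i)),
          (y.1 - fun i => ((((ℓ + 1) ^ k : ℕ) : ℤ)) * s i) ∉ boxDom (fun i => (ℓ + 1) ^ k * M i) →
            Db ≤ supNorm ((emb (hs.scale ((ℓ + 1) ^ k)) x).1 - y.1)) →
        (∀ z, f z ≠ 0 → ∀ y : ↥(boxDom (fun i => (ℓ + 1) ^ k * M0 i)),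
          (y.1 - fun i => ((((ℓ + 1) ^ k : ℕ) : ℤ)) * s i) ∉ boxDom (fun i => (ℓ + 1) ^ k * M i) →
            Df ≤ supNorm ((emb (hs.scale ((ℓ + 1) ^ k)) z).1 - y.1)) →
        |dG ((ℓ + 1) ^ k) a m2 hs f x|
          ≤ c₀ * Real.exp (-(δ₀ * D / (((ℓ + 1) ^ k : ℕ) : ℝ)))
              * Real.exp (-(δ₀ * Db / (((ℓ + 1) ^ k : ℕ) : ℝ) + δ₀ * Df / (((ℓ + 1) ^ k : ℕ) : ℝ))) * F := by
  obtain ⟨δ, c, hδ, hc, H⟩ := bounds_common (fun a _ => a)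
    (thm110_zero_box_roww_coeff d ℓ hℓ amin aplus m2plus ha)
    (thm110_zero_box_deriv_roww_coeff d ℓ hℓ amin aplus m2plus ha)
  have hAb : 0 ≤ max amin aplus := ha.le.trans (le_max_left _ _)
  refine ⟨δ / 2, cCore d (max amin aplus) δ c, half_pos hδ, cCore_pos d hAb hc, ?_⟩
  intro k hk a m2 h1 h2 h3 h4 M M0 s hs hM f F hF x D Db Df hD hDb hDf
  have hcoef : ∀ (k : ℕ), 1 ≤ k → ∀ a, amin ≤ a → a ≤ aplus →
      0 < (fun a _ => a : ℝ → ℕ → ℝ) a k ∧ (fun a _ => a : ℝ → ℕ → ℝ) a k ≤ max amin aplus :=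
    fun k _ a h1 h2 => ⟨lt_of_lt_of_le ha h1, h2.trans (le_max_right _ _)⟩
  have h := (delta112_of_bounds hℓ _ hcoef hδ hc H k hk a m2 h1 h2 h3 h4 M M0 s hs hM f F hF x D Db Df
    hD hDb hDf).1
  simpa only [dfac, mul_assoc] using h

/-- the derivative clause of (1.10)·(1.12) for `δG` at `A = 0`, nested boxes, literal coefficient `a`.
[cite: Balaban1983RegularityDecay, p. 573 Theorem (Prop. 2.1 of [1]) (1.10)–(1.12) with (1.6) p. 572; p. 579] -/
theorem delta112_zero_box_deriv_coeff (d ℓ : ℕ) (hℓ : 1 ≤ ℓ) (amin aplus m2plus : ℝ) (ha : 0 < amin) :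
    ∃ δ₀ c₀ : ℝ, 0 < δ₀ ∧ 0 < c₀ ∧ ∀ (k : ℕ), 1 ≤ k → ∀ (a m2 : ℝ), amin ≤ a → a ≤ aplus → 0 ≤ m2 →
      m2 ≤ m2plus → ∀ (M M0 : Fin (d + 1) → ℕ) (s : Fin (d + 1) → ℤ) (hs : Fits M M0 s), (∀ i, 1 ≤ M i) →
      ∀ (f : ↥(boxDom (fun i => (ℓ + 1) ^ k * M i)) → ℝ) (F : ℝ), (∀ z, |f z| ≤ F) →
      ∀ (μ : Fin (d + 1)) (x xe : ↥(boxDom (fun i => (ℓ + 1) ^ k * M i))), xe.1 = x.1 + Pi.single μ 1 →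
      ∀ (D Db Df : ℝ),
        (∀ z, f z ≠ 0 → D ≤ supNorm (x.1 - z.1)) →
        (∀ y : ↥(boxDom (fun i => (ℓ + 1) ^ k * M0 i)),
          (y.1 - fun i => ((((ℓ + 1) ^ k : ℕ) : ℤ)) * s i) ∉ boxDom (fun i => (ℓ + 1) ^ k * M i) →
            Db ≤ supNorm ((emb (hs.scale ((ℓ + 1) ^ k)) x).1 - y.1)) →
        (∀ z, f z ≠ 0 → ∀ y : ↥(boxDom (fun i => (ℓ + 1) ^ k * M0 i)),
          (y.1 - fun i => ((((ℓ + 1) ^ k : ℕ) : ℤ)) * s i) ∉ boxDom (fun i => (ℓ + 1) ^ k * M i) →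
            Df ≤ supNorm ((emb (hs.scale ((ℓ + 1) ^ k)) z).1 - y.1)) →
        |(((ℓ + 1) ^ k : ℕ) : ℝ) * (dG ((ℓ + 1) ^ k) a m2 hs f xe - dG ((ℓ + 1) ^ k) a m2 hs f x)|
          ≤ c₀ * Real.exp (-(δ₀ * D / (((ℓ + 1) ^ k : ℕ) : ℝ)))
              * Real.exp (-(δ₀ * Db / (((ℓ + 1) ^ k : ℕ) : ℝ) + δ₀ * Df / (((ℓ + 1) ^ k : ℕ) : ℝ))) * F := by
  obtain ⟨δ, c, hδ, hc, H⟩ := bounds_common (fun a _ => a)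
    (thm110_zero_box_roww_coeff d ℓ hℓ amin aplus m2plus ha)
    (thm110_zero_box_deriv_roww_coeff d ℓ hℓ amin aplus m2plus ha)
  have hAb : 0 ≤ max amin aplus := ha.le.trans (le_max_left _ _)
  refine ⟨δ / 2, cCore d (max amin aplus) δ c, half_pos hδ, cCore_pos d hAb hc, ?_⟩
  intro k hk a m2 h1 h2 h3 h4 M M0 s hs hM f F hF μ x xe hxe D Db Df hD hDb hDf
  have hcoef : ∀ (k : ℕ), 1 ≤ k → ∀ a, amin ≤ a → a ≤ aplus →
      0 < (fun a _ => a : ℝ → ℕ → ℝ) a k ∧ (fun a _ => a : ℝ → ℕ → ℝ) a k ≤ max amin aplus :=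
    fun k _ a h1 h2 => ⟨lt_of_lt_of_le ha h1, h2.trans (le_max_right _ _)⟩
  have h := (delta112_of_bounds hℓ _ hcoef hδ hc H k hk a m2 h1 h2 h3 h4 M M0 s hs hM f F hF x D Db Df
    hD hDb hDf).2 μ xe hxe
  simpa only [dfac, mul_assoc] using h

end Final

/-! ## §8 Non-vacuity: the hypotheses are met

(`d + 1 = 4`, `L = 2`, window `a ∈ [1/2, 2]`, `m² ∈ [0, 1]`; a genuinely nested pair `Ω = 1 + [0,1)^4 ⊂ Ω₀ = [0,3)^4`,
and the thin case `Ω = Ω₀`.) -/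

section NonVacuity

/-- the value clause at the physical dimension `d + 1 = 4`, `L = 2`, window `[1/2, 2] × [0, 1]`. -/
example : ∃ δ₀ c₀ : ℝ, 0 < δ₀ ∧ 0 < c₀ ∧ ∀ (k : ℕ), 1 ≤ k → ∀ (a m2 : ℝ), (1 / 2 : ℝ) ≤ a → a ≤ 2 → 0 ≤ m2 →
      m2 ≤ 1 → ∀ (M M0 : Fin (3 + 1) → ℕ) (s : Fin (3 + 1) → ℤ) (hs : Fits M M0 s), (∀ i, 1 ≤ M i) →
      ∀ (f : ↥(boxDom (fun i => (1 + 1) ^ k * M i)) → ℝ) (F : ℝ), (∀ z, |f z| ≤ F) →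
      ∀ (x : ↥(boxDom (fun i => (1 + 1) ^ k * M i))) (D Db Df : ℝ),
        (∀ z, f z ≠ 0 → D ≤ supNorm (x.1 - z.1)) →
        (∀ y : ↥(boxDom (fun i => (1 + 1) ^ k * M0 i)),
          (y.1 - fun i => ((((1 + 1) ^ k : ℕ) : ℤ)) * s i) ∉ boxDom (fun i => (1 + 1) ^ k * M i) →
            Db ≤ supNorm ((emb (hs.scale ((1 + 1) ^ k)) x).1 - y.1)) →
        (∀ z, f z ≠ 0 → ∀ y : ↥(boxDom (fun i => (1 + 1) ^ k * M0 i)),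
          (y.1 - fun i => ((((1 + 1) ^ k : ℕ) : ℤ)) * s i) ∉ boxDom (fun i => (1 + 1) ^ k * M i) →
            Df ≤ supNorm ((emb (hs.scale ((1 + 1) ^ k)) z).1 - y.1)) →
        |dG ((1 + 1) ^ k) (B1.aSeq a ((1 : ℕ) + 1 : ℝ) k) m2 hs f x|
          ≤ c₀ * Real.exp (-(δ₀ * D / (((1 + 1) ^ k : ℕ) : ℝ)))
              * Real.exp (-(δ₀ * Db / (((1 + 1) ^ k : ℕ) : ℝ) + δ₀ * Df / (((1 + 1) ^ k : ℕ) : ℝ))) * F :=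
  delta112_zero_box_value 3 1 le_rfl (1 / 2) 2 1 (by norm_num)

/-- the derivative clause with the literal coefficient at `d + 1 = 4`, `L = 2`, window `[1/2, 2] × [0, 1]`. -/
example : ∃ δ₀ c₀ : ℝ, 0 < δ₀ ∧ 0 < c₀ ∧ ∀ (k : ℕ), 1 ≤ k → ∀ (a m2 : ℝ), (1 / 2 : ℝ) ≤ a → a ≤ 2 → 0 ≤ m2 →
      m2 ≤ 1 → ∀ (M M0 : Fin (3 + 1) → ℕ) (s : Fin (3 + 1) → ℤ) (hs : Fits M M0 s), (∀ i, 1 ≤ M i) →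
      ∀ (f : ↥(boxDom (fun i => (1 + 1) ^ k * M i)) → ℝ) (F : ℝ), (∀ z, |f z| ≤ F) →
      ∀ (μ : Fin (3 + 1)) (x xe : ↥(boxDom (fun i => (1 + 1) ^ k * M i))), xe.1 = x.1 + Pi.single μ 1 →
      ∀ (D Db Df : ℝ),
        (∀ z, f z ≠ 0 → D ≤ supNorm (x.1 - z.1)) →
        (∀ y : ↥(boxDom (fun i => (1 + 1) ^ k * M0 i)),
          (y.1 - fun i => ((((1 + 1) ^ k : ℕ) : ℤ)) * s i) ∉ boxDom (fun i => (1 + 1) ^ k * M i) →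
            Db ≤ supNorm ((emb (hs.scale ((1 + 1) ^ k)) x).1 - y.1)) →
        (∀ z, f z ≠ 0 → ∀ y : ↥(boxDom (fun i => (1 + 1) ^ k * M0 i)),
          (y.1 - fun i => ((((1 + 1) ^ k : ℕ) : ℤ)) * s i) ∉ boxDom (fun i => (1 + 1) ^ k * M i) →
            Df ≤ supNorm ((emb (hs.scale ((1 + 1) ^ k)) z).1 - y.1)) →
        |(((1 + 1) ^ k : ℕ) : ℝ) * (dG ((1 + 1) ^ k) a m2 hs f xe - dG ((1 + 1) ^ k) a m2 hs f x)|
          ≤ c₀ * Real.exp (-(δ₀ * D / (((1 + 1) ^ k : ℕ) : ℝ)))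
              * Real.exp (-(δ₀ * Db / (((1 + 1) ^ k : ℕ) : ℝ) + δ₀ * Df / (((1 + 1) ^ k : ℕ) : ℝ))) * F :=
  delta112_zero_box_deriv_coeff 3 1 le_rfl (1 / 2) 2 1 (by norm_num)

/-- a genuinely nested pair: `Ω = 1 + [0,1)^4 ⊂ Ω₀ = [0,3)^4`, `M_μ = 1 ≥ 1`. -/
example : Fits (fun _ : Fin (3 + 1) => 1) (fun _ => 3) (fun _ => 1) ∧ ∀ i, 1 ≤ (fun _ : Fin (3 + 1) => 1) i :=
  ⟨fun _ => ⟨by norm_num, by norm_num⟩, fun _ => le_rfl⟩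

/-- the thin case `Ω = Ω₀ = [0,1)^4` (`s = 0`) is admissible too (then `Ω₀∖Ω = ∅` and `D_b`, `D_f` are free). -/
example : Fits (fun _ : Fin (3 + 1) => 1) (fun _ => 1) (fun _ => 0) :=
  fun _ => ⟨le_rfl, by norm_num⟩

/-- the distance hypotheses are always met by `D = D_b = D_f = 0`. -/
example {n : ℕ} {M M0 : Fin (d + 1) → ℕ} {s : Fin (d + 1) → ℤ} (hs : Fits M M0 s)
    (f : ↥(boxDom (fun i => n * M i)) → ℝ) (x : ↥(boxDom (fun i => n * M i))) :
    (∀ z, f z ≠ 0 → (0 : ℝ) ≤ supNorm (x.1 - z.1)) ∧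
    (∀ y : ↥(boxDom (fun i => n * M0 i)),
      (y.1 - fun i => (n : ℤ) * s i) ∉ boxDom (fun i => n * M i) → (0 : ℝ) ≤ supNorm ((emb (hs.scale n) x).1 - y.1)) ∧
    (∀ z : ↥(boxDom (fun i => n * M i)), f z ≠ 0 → ∀ y : ↥(boxDom (fun i => n * M0 i)),
      (y.1 - fun i => (n : ℤ) * s i) ∉ boxDom (fun i => n * M i) →
        (0 : ℝ) ≤ supNorm ((emb (hs.scale n) z).1 - y.1)) :=
  ⟨fun _ _ => supNorm_nonneg _, fun _ _ => supNorm_nonneg _, fun _ _ _ _ => supNorm_nonneg _⟩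

end NonVacuity

end

end Literature.MathematicalPhysics.QuantumFieldTheory.Balaban1983to89.B4Delta112ZeroBox
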